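import Literature.Analysis.UnboundedOperators.HeatIteratedDerivBounds
import HarnessLib

/-!
# Slice Duhamel integrals of the heat semigroup: derivatives, Hölder and time regularity

Analysis/UnboundedOperators support file (everything proved; no definitions, no named facts),
written for the all-orders bootstrap in the proof of the named fact
`Literature.Analysis.FluidPDE.jia_sverak_2014_local_higher_regularity` (H. Jia, V. Šverák,
Invent. Math. 196 (2014) = arXiv:1204.0529, §3, Thm 3.2 and the paragraph after its proof, p. 9:
"Since we can get an estimate of ∫₀ᵗ ∇e^{Δ(t-s)}[-div(u ⊗ uη)] ds in C^{0,α}ₓ … for fixed t from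
the estimate ∇ₓu ∈ L^∞ₜ C^α_{x,loc}, we can bootstrap to obtain estimates of higher spatial
derivatives. The estimates for ∂ₜ∂ₓ^α u … follow from differentiating the equation"). The
Duhamel terms of the localised equation are, slice by slice, integrals

  `J[g](t, x) = ∫₀ᵗ e^{(t-s)Δ} g(s) (x) ds`

of a measurable family `g : ℝ → E → F` of bounded continuous slices (the tree's caloric extension
`UnboundedOperators.heatExtension`, on a finite-dimensional real inner product space `E`, values
in a Banach space `F`; the multiplier terms `∫₀ᵗ ∂ᵥe^{(t-s)Δ}g(s) ds` are `∂ᵥJ[g]`). This file is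
the quantitative regularity theory of `J[g]` in the space variable, with explicit constants
depending only on `d = dim E` and the Hölder exponent:

* kernel bounds on Hölder data (`‖h(y) - h(z)‖ ≤ A‖y - z‖^β`):
  `‖D e^{σΔ}h‖ ≤ K₁Aσ^{(β-1)/2}`, `‖D² e^{σΔ}h‖ ≤ K₂Aσ^{(β-2)/2}`, `‖D³ e^{σΔ}h‖ ≤ K₃Aσ^{(β-3)/2}`
  (`norm_fderiv_heatExtension_le_holder`, `norm_iteratedFDeriv_two_heatExtension_le_holder`,
  `norm_iteratedFDeriv_three_heatExtension_le_holder`; the tree's order-one Hölder gain and the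
  semigroup law);
* measurability of the lifts `(s, y) ↦ e^{(t-s)Δ}g(s)(y)` and of their derivatives
  (`stronglyMeasurable_heatExtension_slice`, `stronglyMeasurable_indicator_fderiv(_apply)`:
  derivatives of measurable families of differentiable slices are measurable, by difference
  quotients);
* `J[g]` for bounded data: `‖J[g]‖ ≤ Ct`, differentiation under the integral
  (`hasFDerivAt_duhamel`, majorant `2^{d/2}C(t-s)^{-1/2}`), `‖DJ[g]‖ ≤ 2·2^{d/2}C√t`
  (`norm_fderiv_duhamel_le`);
* `J[g]` for Hölder data: `DJ[g]` is again differentiable under the integral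
  (`hasFDerivAt_fderiv_duhamel`, majorant `K₂A(t-s)^{(β-2)/2}`), `‖D²J[g]‖ ≤ K₂A(2/β)t^{β/2}`
  (`norm_fderiv_fderiv_duhamel_le`) and **`D²J[g]` is `β`-Hölder with constant
  `(4K₂/β + 2K₃/(1-β))A`** (`norm_fderiv_fderiv_duhamel_sub_le`, `0 < β < 1`: the integrand
  difference is `≤ 2K₂A(t-s)^{(β-2)/2}` and `≤ K₃A(t-s)^{(β-3)/2}‖x-x'‖`, split at
  `t - s = ‖x - x'‖²`) — the gain of one derivative of the print;
* derivatives fall on differentiable data: `D(J[g]) = J[Dg]`, `Dᵏ(J[g]) = J[Dᵏg]` for `Cᵏ` data with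
  bounded derivatives (`fderiv_duhamel_eq`, `iteratedFDeriv_duhamel_eq`), so that the bounds
  iterate to all orders;
* time regularity: `‖e^{hΔ}k - k‖ ≤ d‖D²k‖_∞ h` (`norm_heatExtension_sub_self_le_of_C2`) and the
  Lipschitz bound `‖J[g](t) - J[g](t')‖ ≤ (C + dK₂A(2/β)t'^{β/2})(t - t')` for Hölder data
  (`norm_duhamel_sub_duhamel_time_le`).

## References

* H. Jia, V. Šverák, Invent. Math. 196 (2014) = arXiv:1204.0529, §3 (p. 9). Bib key
  `JiaSverak2014`.
* Y. Giga, M.-H. Giga, J. Saal, *Nonlinear PDEs* (2010), §1.1.3 (derivative estimates for the heat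
  semigroup). Bib key `GigaGigaSaal2010`.
* T. Buckmaster, C. De Lellis, L. Székelyhidi Jr., V. Vicol, CPAM 72 (2019), §2.2 (mollification
  estimates on Hölder data). Bib key `BuckmasterEtAl2018`.
-/

noncomputable section

open MeasureTheory Set Function Filter Metric InnerProductSpace
open _root_.Topology
open scoped ENNReal NNReal Laplacian

namespace Literature.Analysis.UnboundedOperators

namespace HeatHolder

-- nested operator types `E →L[ℝ] E →L[ℝ] E →L[ℝ] F`
set_option maxSynthPendingDepth 3

variable {E : Type*} [NormedAddCommGroup E] [InnerProductSpace ℝ E] [FiniteDimensional ℝ E]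
  [MeasurableSpace E] [BorelSpace E]
variable {F : Type*} [NormedAddCommGroup F] [NormedSpace ℝ F] [CompleteSpace F]

/-- **One derivative on Hölder data** (`k = 1`): `‖D(e^{σΔ}h)(x)‖ ≤ K₁ A σ^{(β-1)/2}` for continuous
bounded `h` with `‖h y - h z‖ ≤ A ‖y - z‖^β`, `0 ≤ β ≤ 1` (the tree's
`norm_fderiv_heatExtension_le_of_holder`, with the powers of `σ` collected:
`σ^{-1/2} (2σ)^{β/2} = 2^{β/2} σ^{(β-1)/2} ≤ 2 σ^{(β-1)/2}`). [folklore] -/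
theorem norm_fderiv_heatExtension_le_holder {h : E → F} (hh : Continuous h) {C : ℝ}
    (hC : ∀ z, ‖h z‖ ≤ C) {A β : ℝ} (hA : 0 ≤ A) (hβ0 : 0 ≤ β) (hβ1 : β ≤ 1)
    (hH : ∀ y z, ‖h y - h z‖ ≤ A * ‖y - z‖ ^ β) {σ : ℝ} (hσ : 0 < σ) (x : E) :
    ‖fderiv ℝ (heatExtension h σ) x‖ ≤
      (2 * (2 : ℝ) ^ ((Module.finrank ℝ E : ℝ) / 2) * (1 + 2 * (2 : ℝ) ^ ((Module.finrank ℝ E : ℝ) / 2))) *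
        A * σ ^ ((β - 1) / 2) := by
  have h1 := norm_fderiv_heatExtension_le_of_holder hh hC hA hβ0 hβ1 hH hσ x
  refine h1.trans ?_
  set c : ℝ := (2 : ℝ) ^ ((Module.finrank ℝ E : ℝ) / 2) with hc
  have hc0 : 0 ≤ c := by positivity
  -- `σ^{-1/2} (2σ)^{β/2} = 2^{β/2} σ^{(β-1)/2} ≤ 2 σ^{(β-1)/2}`
  have hpow : σ ^ (-(1 / 2 : ℝ)) * (2 * σ) ^ (β / 2) ≤ 2 * σ ^ ((β - 1) / 2) := by
    rw [Real.mul_rpow (by norm_num) hσ.le, show (β - 1) / 2 = -(1 / 2 : ℝ) + β / 2 by ring,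
      Real.rpow_add hσ]
    have h2 : (2 : ℝ) ^ (β / 2) ≤ 2 := by
      calc (2 : ℝ) ^ (β / 2) ≤ (2 : ℝ) ^ (1 : ℝ) :=
            Real.rpow_le_rpow_of_exponent_le (by norm_num) (by linarith)
        _ = 2 := Real.rpow_one 2
    have hσ1 : 0 ≤ σ ^ (-(1 / 2 : ℝ)) := Real.rpow_nonneg hσ.le _
    have hσ2 : 0 ≤ σ ^ (β / 2) := Real.rpow_nonneg hσ.le _
    calc σ ^ (-(1 / 2 : ℝ)) * ((2 : ℝ) ^ (β / 2) * σ ^ (β / 2))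
        = (2 : ℝ) ^ (β / 2) * (σ ^ (-(1 / 2 : ℝ)) * σ ^ (β / 2)) := by ring
      _ ≤ 2 * (σ ^ (-(1 / 2 : ℝ)) * σ ^ (β / 2)) :=
          mul_le_mul_of_nonneg_right h2 (mul_nonneg hσ1 hσ2)
  calc c * σ ^ (-(1 / 2 : ℝ)) * ((1 + 2 * c) * (2 * σ) ^ (β / 2)) * A
      = c * (1 + 2 * c) * A * (σ ^ (-(1 / 2 : ℝ)) * (2 * σ) ^ (β / 2)) := by ring
    _ ≤ c * (1 + 2 * c) * A * (2 * σ ^ ((β - 1) / 2)) := by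
        refine mul_le_mul_of_nonneg_left hpow ?_
        positivity
    _ = 2 * c * (1 + 2 * c) * A * σ ^ ((β - 1) / 2) := by ring

/-- Halving the time costs at most a factor `4` in negative powers of order `≥ -2`:
`(σ/2)^γ ≤ 4 σ^γ` for `-2 ≤ γ ≤ 0`. [folklore] -/
theorem half_rpow_le {σ γ : ℝ} (hσ : 0 < σ) (hγ : -2 ≤ γ) :
    (σ / 2) ^ γ ≤ 4 * σ ^ γ := by
  rw [div_eq_mul_inv, Real.mul_rpow hσ.le (by norm_num), mul_comm]
  refine mul_le_mul_of_nonneg_right ?_ (Real.rpow_nonneg hσ.le _)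
  rw [Real.inv_rpow (by norm_num), ← Real.rpow_neg (by norm_num)]
  calc (2 : ℝ) ^ (-γ) ≤ (2 : ℝ) ^ (2 : ℝ) := Real.rpow_le_rpow_of_exponent_le (by norm_num) (by linarith)
    _ = 4 := by norm_num

/-- The semigroup law on bounded continuous data, halving the time:
`e^{σΔ}h = e^{(σ/2)Δ}(e^{(σ/2)Δ}h)`. [folklore] -/
theorem heatExtension_eq_heatExtension_half {h : E → F} (hh : Continuous h) {C : ℝ}
    (hC : ∀ z, ‖h z‖ ≤ C) {σ : ℝ} (hσ : 0 < σ) :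
    heatExtension h σ = heatExtension (heatExtension h (σ / 2)) (σ / 2) := by
  rw [heatExtension_add_holds (memLp_top_of_continuous_of_bound hh hC) le_top (half_pos hσ) (half_pos hσ),
    add_halves]

/-- **Two derivatives on Hölder data**: `‖D²(e^{σΔ}h)(x)‖ ≤ K₂ A σ^{(β-2)/2}` (semigroup law: one
derivative gained on top of the `C¹` function `e^{(σ/2)Δ}h`, whose gradient is bounded by the
order-one estimate). [folklore] -/
theorem norm_iteratedFDeriv_two_heatExtension_le_holder {h : E → F} (hh : Continuous h) {C : ℝ}
    (hC : ∀ z, ‖h z‖ ≤ C) {A β : ℝ} (hA : 0 ≤ A) (hβ0 : 0 ≤ β) (hβ1 : β ≤ 1)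
    (hH : ∀ y z, ‖h y - h z‖ ≤ A * ‖y - z‖ ^ β) {σ : ℝ} (hσ : 0 < σ) (x : E) :
    ‖iteratedFDeriv ℝ 2 (heatExtension h σ) x‖ ≤
      (4 * (2 : ℝ) ^ ((Module.finrank ℝ E : ℝ) / 2) *
        (2 * (2 : ℝ) ^ ((Module.finrank ℝ E : ℝ) / 2) * (1 + 2 * (2 : ℝ) ^ ((Module.finrank ℝ E : ℝ) / 2)))) *
        A * σ ^ ((β - 2) / 2) := by
  set c : ℝ := (2 : ℝ) ^ ((Module.finrank ℝ E : ℝ) / 2) with hc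
  set K₁ : ℝ := 2 * c * (1 + 2 * c) with hK₁
  have hc0 : 0 ≤ c := by positivity
  have hK₁0 : 0 ≤ K₁ := by positivity
  have hσ2 : 0 < σ / 2 := half_pos hσ
  set k : E → F := heatExtension h (σ / 2) with hk
  have hk1 : ContDiff ℝ 1 k := contDiff_heatExtension_of_bound hh hC hσ2
  have hk0 : ∀ z, ‖k z‖ ≤ C := fun z => norm_heatExtension_le_of_bound hC hσ2 z
  have hkd : ∀ z, ‖fderiv ℝ k z‖ ≤ K₁ * A * (σ / 2) ^ ((β - 1) / 2) := fun z =>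
    norm_fderiv_heatExtension_le_holder hh hC hA hβ0 hβ1 hH hσ2 z
  set Ck : ℕ → ℝ := fun j => if j = 0 then C else K₁ * A * (σ / 2) ^ ((β - 1) / 2) with hCk
  have hCk : ∀ j ≤ 1, ∀ z, ‖iteratedFDeriv ℝ j k z‖ ≤ Ck j := by
    intro j hj z
    interval_cases j
    · show ‖iteratedFDeriv ℝ 0 k z‖ ≤ C
      rw [norm_iteratedFDeriv_zero]; exact hk0 z
    · show ‖iteratedFDeriv ℝ 1 k z‖ ≤ K₁ * A * (σ / 2) ^ ((β - 1) / 2)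
      rw [norm_iteratedFDeriv_one]; exact hkd z
  rw [heatExtension_eq_heatExtension_half hh hC hσ]
  have h2 := norm_iteratedFDeriv_succ_heatExtension_le_of_bounded (n := 1) hk1 hCk hσ2 x
  have hCk1 : Ck 1 = K₁ * A * (σ / 2) ^ ((β - 1) / 2) := rfl
  rw [hCk1] at h2
  refine h2.trans ?_
  -- collect the powers: `(σ/2)^{-1/2} (σ/2)^{(β-1)/2} = (σ/2)^{(β-2)/2} ≤ 4 σ^{(β-2)/2}`
  have hpow : (σ / 2) ^ (-(1 / 2 : ℝ)) * (σ / 2) ^ ((β - 1) / 2) ≤ 4 * σ ^ ((β - 2) / 2) := by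
    rw [← Real.rpow_add hσ2, show -(1 / 2 : ℝ) + (β - 1) / 2 = (β - 2) / 2 by ring]
    exact half_rpow_le hσ (by linarith)
  calc c * (σ / 2) ^ (-(1 / 2 : ℝ)) * (K₁ * A * (σ / 2) ^ ((β - 1) / 2))
      = c * K₁ * A * ((σ / 2) ^ (-(1 / 2 : ℝ)) * (σ / 2) ^ ((β - 1) / 2)) := by ring
    _ ≤ c * K₁ * A * (4 * σ ^ ((β - 2) / 2)) := mul_le_mul_of_nonneg_left hpow (by positivity)
    _ = 4 * c * K₁ * A * σ ^ ((β - 2) / 2) := by ring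

/-- **Three derivatives on Hölder data**: `‖D³(e^{σΔ}h)(x)‖ ≤ K₃ A σ^{(β-3)/2}` (semigroup law once
more, on top of the `C²` function `e^{(σ/2)Δ}h`). [folklore] -/
theorem norm_iteratedFDeriv_three_heatExtension_le_holder {h : E → F} (hh : Continuous h) {C : ℝ}
    (hC : ∀ z, ‖h z‖ ≤ C) {A β : ℝ} (hA : 0 ≤ A) (hβ0 : 0 ≤ β) (hβ1 : β ≤ 1)
    (hH : ∀ y z, ‖h y - h z‖ ≤ A * ‖y - z‖ ^ β) {σ : ℝ} (hσ : 0 < σ) (x : E) :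
    ‖iteratedFDeriv ℝ 3 (heatExtension h σ) x‖ ≤
      (4 * (2 : ℝ) ^ ((Module.finrank ℝ E : ℝ) / 2) * (4 * (2 : ℝ) ^ ((Module.finrank ℝ E : ℝ) / 2) *
        (2 * (2 : ℝ) ^ ((Module.finrank ℝ E : ℝ) / 2) * (1 + 2 * (2 : ℝ) ^ ((Module.finrank ℝ E : ℝ) / 2))))) *
        A * σ ^ ((β - 3) / 2) := by
  set c : ℝ := (2 : ℝ) ^ ((Module.finrank ℝ E : ℝ) / 2) with hc
  set K₁ : ℝ := 2 * c * (1 + 2 * c) with hK₁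
  set K₂ : ℝ := 4 * c * K₁ with hK₂
  have hc0 : 0 ≤ c := by positivity
  have hK₁0 : 0 ≤ K₁ := by positivity
  have hK₂0 : 0 ≤ K₂ := by positivity
  have hσ2 : 0 < σ / 2 := half_pos hσ
  set k : E → F := heatExtension h (σ / 2) with hk
  have hk2 : ContDiff ℝ 2 k := contDiff_heatExtension_of_bound hh hC hσ2
  have hk0 : ∀ z, ‖k z‖ ≤ C := fun z => norm_heatExtension_le_of_bound hC hσ2 z
  have hkd : ∀ z, ‖fderiv ℝ k z‖ ≤ K₁ * A * (σ / 2) ^ ((β - 1) / 2) := fun z =>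
    norm_fderiv_heatExtension_le_holder hh hC hA hβ0 hβ1 hH hσ2 z
  have hkdd : ∀ z, ‖iteratedFDeriv ℝ 2 k z‖ ≤ K₂ * A * (σ / 2) ^ ((β - 2) / 2) := fun z =>
    norm_iteratedFDeriv_two_heatExtension_le_holder hh hC hA hβ0 hβ1 hH hσ2 z
  set Ck : ℕ → ℝ := fun j => if j = 0 then C else if j = 1 then K₁ * A * (σ / 2) ^ ((β - 1) / 2)
    else K₂ * A * (σ / 2) ^ ((β - 2) / 2) with hCk
  have hCk : ∀ j ≤ 2, ∀ z, ‖iteratedFDeriv ℝ j k z‖ ≤ Ck j := by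
    intro j hj z
    interval_cases j
    · show ‖iteratedFDeriv ℝ 0 k z‖ ≤ C
      rw [norm_iteratedFDeriv_zero]; exact hk0 z
    · show ‖iteratedFDeriv ℝ 1 k z‖ ≤ K₁ * A * (σ / 2) ^ ((β - 1) / 2)
      rw [norm_iteratedFDeriv_one]; exact hkd z
    · show ‖iteratedFDeriv ℝ 2 k z‖ ≤ K₂ * A * (σ / 2) ^ ((β - 2) / 2)
      exact hkdd z
  rw [heatExtension_eq_heatExtension_half hh hC hσ]
  have h3 := norm_iteratedFDeriv_succ_heatExtension_le_of_bounded (n := 2) hk2 hCk hσ2 x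
  have hCk2 : Ck 2 = K₂ * A * (σ / 2) ^ ((β - 2) / 2) := rfl
  rw [hCk2] at h3
  refine h3.trans ?_
  have hpow : (σ / 2) ^ (-(1 / 2 : ℝ)) * (σ / 2) ^ ((β - 2) / 2) ≤ 4 * σ ^ ((β - 3) / 2) := by
    rw [← Real.rpow_add hσ2, show -(1 / 2 : ℝ) + (β - 2) / 2 = (β - 3) / 2 by ring]
    exact half_rpow_le hσ (by linarith)
  calc c * (σ / 2) ^ (-(1 / 2 : ℝ)) * (K₂ * A * (σ / 2) ^ ((β - 2) / 2))
      = c * K₂ * A * ((σ / 2) ^ (-(1 / 2 : ℝ)) * (σ / 2) ^ ((β - 2) / 2)) := by ring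
    _ ≤ c * K₂ * A * (4 * σ ^ ((β - 3) / 2)) := mul_le_mul_of_nonneg_left hpow (by positivity)
    _ = 4 * c * K₂ * A * σ ^ ((β - 3) / 2) := by ring

/-! ## Calculus glue: directional derivatives and operator norms of iterated derivatives -/

omit [InnerProductSpace ℝ E] [FiniteDimensional ℝ E] [MeasurableSpace E] [BorelSpace E] [CompleteSpace F] in
/-- `‖D(y ↦ Df(y)v)(x)‖ ≤ ‖D²f(x)‖ ‖v‖` for `f ∈ C²`. [folklore] -/
theorem norm_fderiv_fderiv_apply_le {E' : Type*} [NormedAddCommGroup E'] [NormedSpace ℝ E']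
    {f : E' → F} (hf : ContDiff ℝ 2 f) (x v : E') :
    ‖fderiv ℝ (fun y => fderiv ℝ f y v) x‖ ≤ ‖iteratedFDeriv ℝ 2 f x‖ * ‖v‖ := by
  have hd : DifferentiableAt ℝ (fderiv ℝ f) x :=
    ((hf.fderiv_right (m := 1) le_rfl).differentiable one_ne_zero) x
  have h1 : fderiv ℝ (fun y => fderiv ℝ f y v) x = (ContinuousLinearMap.apply ℝ F v).comp (fderiv ℝ (fderiv ℝ f) x) := by
    rw [show (fun y => fderiv ℝ f y v) = (ContinuousLinearMap.apply ℝ F v) ∘ fderiv ℝ f from rfl,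
      fderiv_comp x (ContinuousLinearMap.apply ℝ F v).differentiableAt hd, ContinuousLinearMap.fderiv]
  rw [h1]
  have hle : ‖(ContinuousLinearMap.apply ℝ F v).comp (fderiv ℝ (fderiv ℝ f) x)‖ ≤ ‖fderiv ℝ (fderiv ℝ f) x‖ * ‖v‖ := by
    refine ContinuousLinearMap.opNorm_le_bound _ (by positivity) fun w => ?_
    calc ‖((ContinuousLinearMap.apply ℝ F v).comp (fderiv ℝ (fderiv ℝ f) x)) w‖ = ‖(fderiv ℝ (fderiv ℝ f) x w) v‖ := rfl
      _ ≤ ‖fderiv ℝ (fderiv ℝ f) x w‖ * ‖v‖ := ContinuousLinearMap.le_opNorm _ _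
      _ ≤ ‖fderiv ℝ (fderiv ℝ f) x‖ * ‖w‖ * ‖v‖ := by gcongr; exact ContinuousLinearMap.le_opNorm _ _
      _ = ‖fderiv ℝ (fderiv ℝ f) x‖ * ‖v‖ * ‖w‖ := by ring
  refine hle.trans (le_of_eq ?_)
  rw [← norm_iteratedFDeriv_one (𝕜 := ℝ) (fderiv ℝ f), norm_iteratedFDeriv_fderiv]

omit [InnerProductSpace ℝ E] [FiniteDimensional ℝ E] [MeasurableSpace E] [BorelSpace E] [CompleteSpace F] in
/-- `y ↦ Df(y)v` is `Cⁿ` when `f ∈ Cⁿ⁺¹`. [folklore] -/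
theorem contDiff_fderiv_apply_const {E' : Type*} [NormedAddCommGroup E'] [NormedSpace ℝ E']
    {f : E' → F} {n : ℕ} (hf : ContDiff ℝ (n + 1) f) (v : E') :
    ContDiff ℝ n (fun y => fderiv ℝ f y v) :=
  (hf.fderiv_right (m := n) (by norm_cast)).clm_apply contDiff_const

omit [InnerProductSpace ℝ E] [FiniteDimensional ℝ E] [MeasurableSpace E] [BorelSpace E] [CompleteSpace F] in
/-- `‖D(y ↦ D(y' ↦ Df(y')v)(y))(x)‖ ≤ ‖D³f(x)‖ ‖v‖` for `f ∈ C³`. [folklore] -/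
theorem norm_fderiv_fderiv_fderiv_apply_le {E' : Type*} [NormedAddCommGroup E'] [NormedSpace ℝ E']
    {f : E' → F} (hf : ContDiff ℝ 3 f) (x v : E') :
    ‖fderiv ℝ (fun y => fderiv ℝ (fun y' => fderiv ℝ f y' v) y) x‖ ≤ ‖iteratedFDeriv ℝ 3 f x‖ * ‖v‖ := by
  -- `D(y' ↦ Df(y')v) = (apply v) ∘ D²f`, so its derivative is `(apply v) ∘ D³f` up to currying
  have hg : ContDiff ℝ 2 (fun y' => fderiv ℝ f y' v) := contDiff_fderiv_apply_const (n := 2) hf v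
  have hd2 : Differentiable ℝ (fderiv ℝ f) := (hf.fderiv_right (m := 2) (by norm_cast)).differentiable (by norm_num)
  have h1 : (fun y => fderiv ℝ (fun y' => fderiv ℝ f y' v) y) =
      fun y => (ContinuousLinearMap.apply ℝ F v).comp (fderiv ℝ (fderiv ℝ f) y) := by
    funext y
    rw [show (fun y' => fderiv ℝ f y' v) = (ContinuousLinearMap.apply ℝ F v) ∘ fderiv ℝ f from rfl,
      fderiv_comp y (ContinuousLinearMap.apply ℝ F v).differentiableAt (hd2 y), ContinuousLinearMap.fderiv]
  have hd3 : DifferentiableAt ℝ (fderiv ℝ (fderiv ℝ f)) x :=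
    (((hf.fderiv_right (m := 2) (by norm_cast)).fderiv_right (m := 1) (by norm_cast)).differentiable one_ne_zero) x
  set Lv : (E' →L[ℝ] F) →L[ℝ] F := ContinuousLinearMap.apply ℝ F v with hLv
  set Cv : (E' →L[ℝ] E' →L[ℝ] F) →L[ℝ] (E' →L[ℝ] F) :=
    (ContinuousLinearMap.compL ℝ E' (E' →L[ℝ] F) F) Lv with hCv
  have h2 : (fun y => Lv.comp (fderiv ℝ (fderiv ℝ f) y)) = Cv ∘ fderiv ℝ (fderiv ℝ f) := by
    funext y; simp [hCv]
  rw [h1, h2, fderiv_comp x Cv.differentiableAt hd3, ContinuousLinearMap.fderiv]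
  have hLvM : ∀ M : E' →L[ℝ] E' →L[ℝ] F, ‖Lv.comp M‖ ≤ ‖M‖ * ‖v‖ := by
    intro M
    refine ContinuousLinearMap.opNorm_le_bound _ (by positivity) fun w => ?_
    calc ‖(Lv.comp M) w‖ = ‖(M w) v‖ := rfl
      _ ≤ ‖M w‖ * ‖v‖ := ContinuousLinearMap.le_opNorm _ _
      _ ≤ ‖M‖ * ‖w‖ * ‖v‖ := by gcongr; exact ContinuousLinearMap.le_opNorm _ _
      _ = ‖M‖ * ‖v‖ * ‖w‖ := by ring
  have hle : ‖Cv.comp (fderiv ℝ (fderiv ℝ (fderiv ℝ f)) x)‖ ≤ ‖fderiv ℝ (fderiv ℝ (fderiv ℝ f)) x‖ * ‖v‖ := by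
    refine ContinuousLinearMap.opNorm_le_bound _ (by positivity) fun w => ?_
    calc ‖(Cv.comp (fderiv ℝ (fderiv ℝ (fderiv ℝ f)) x)) w‖ = ‖Lv.comp (fderiv ℝ (fderiv ℝ (fderiv ℝ f)) x w)‖ := rfl
      _ ≤ ‖fderiv ℝ (fderiv ℝ (fderiv ℝ f)) x w‖ * ‖v‖ := hLvM _
      _ ≤ ‖fderiv ℝ (fderiv ℝ (fderiv ℝ f)) x‖ * ‖w‖ * ‖v‖ := by gcongr; exact ContinuousLinearMap.le_opNorm _ _
      _ = ‖fderiv ℝ (fderiv ℝ (fderiv ℝ f)) x‖ * ‖v‖ * ‖w‖ := by ring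
  refine hle.trans (le_of_eq ?_)
  rw [← norm_iteratedFDeriv_one (𝕜 := ℝ) (fderiv ℝ (fderiv ℝ f)), norm_iteratedFDeriv_fderiv,
    norm_iteratedFDeriv_fderiv]

omit [InnerProductSpace ℝ E] [FiniteDimensional ℝ E] [MeasurableSpace E] [BorelSpace E] [CompleteSpace F] in
/-- Mean value inequality for `y ↦ Df(y)v`: `‖Df(x)v - Df(x')v‖ ≤ sup ‖D²f‖ ‖v‖ ‖x - x'‖`. [folklore] -/
theorem norm_fderiv_apply_sub_le {E' : Type*} [NormedAddCommGroup E'] [NormedSpace ℝ E']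
    {f : E' → F} (hf : ContDiff ℝ 2 f) {B : ℝ} (hB : ∀ y, ‖iteratedFDeriv ℝ 2 f y‖ ≤ B) (v x x' : E') :
    ‖fderiv ℝ f x v - fderiv ℝ f x' v‖ ≤ B * ‖v‖ * ‖x - x'‖ := by
  have hB0 : 0 ≤ B := (norm_nonneg _).trans (hB x)
  have hdiff : Differentiable ℝ (fun y => fderiv ℝ f y v) :=
    (contDiff_fderiv_apply_const (n := 1) hf v).differentiable (by norm_num)
  have hbound : ∀ y, ‖fderiv ℝ (fun y => fderiv ℝ f y v) y‖ ≤ B * ‖v‖ := fun y =>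
    (norm_fderiv_fderiv_apply_le hf y v).trans (mul_le_mul_of_nonneg_right (hB y) (norm_nonneg _))
  have := Convex.norm_image_sub_le_of_norm_fderiv_le (fun y _ => hdiff y) (fun y _ => hbound y)
    convex_univ (mem_univ x') (mem_univ x)
  linarith [this]

omit [InnerProductSpace ℝ E] [FiniteDimensional ℝ E] [MeasurableSpace E] [BorelSpace E] [CompleteSpace F] in
/-- Mean value inequality for `y ↦ D(y' ↦ Df(y')v)(y)`:
`‖D(Df·v)(x) - D(Df·v)(x')‖ ≤ sup ‖D³f‖ ‖v‖ ‖x - x'‖`. [folklore] -/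
theorem norm_fderiv_fderiv_apply_sub_le {E' : Type*} [NormedAddCommGroup E'] [NormedSpace ℝ E']
    {f : E' → F} (hf : ContDiff ℝ 3 f) {B : ℝ} (hB : ∀ y, ‖iteratedFDeriv ℝ 3 f y‖ ≤ B) (v x x' : E') :
    ‖fderiv ℝ (fun y => fderiv ℝ f y v) x - fderiv ℝ (fun y => fderiv ℝ f y v) x'‖ ≤ B * ‖v‖ * ‖x - x'‖ := by
  have hdiff : Differentiable ℝ (fun y => fderiv ℝ (fun y' => fderiv ℝ f y' v) y) := by
    have hg : ContDiff ℝ 2 (fun y' => fderiv ℝ f y' v) := contDiff_fderiv_apply_const (n := 2) hf v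
    exact (hg.fderiv_right (m := 1) (by norm_cast)).differentiable one_ne_zero
  have hbound : ∀ y, ‖fderiv ℝ (fun y => fderiv ℝ (fun y' => fderiv ℝ f y' v) y) y‖ ≤ B * ‖v‖ := fun y =>
    (norm_fderiv_fderiv_fderiv_apply_le hf y v).trans (mul_le_mul_of_nonneg_right (hB y) (norm_nonneg _))
  have := Convex.norm_image_sub_le_of_norm_fderiv_le (fun y _ => hdiff y) (fun y _ => hbound y)
    convex_univ (mem_univ x') (mem_univ x)
  linarith [this]

/-! ## Measurability of caloric lifts of measurable families of slices and of their derivatives -/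

section Measurability

omit [CompleteSpace F] in
/-- **The caloric lifts of the slices of a jointly measurable family are jointly measurable**:
for `g : ℝ → E → F` with `uncurry g` strongly measurable and any measurable time change `τ`,
`(s, x) ↦ e^{τ(s)Δ}(g s)(x) = ∫ G_{τ(s)}(y) • g(s, x - y) dy` is strongly measurable (Fubini
measurability of a parametric integral; junk values where `τ(s) ≤ 0` included). [folklore] -/
theorem stronglyMeasurable_heatExtension_slice {g : ℝ → E → F} (hgm : StronglyMeasurable (uncurry g))
    {τ : ℝ → ℝ} (hτ : Measurable τ) :
    StronglyMeasurable fun p : ℝ × E => heatExtension (g p.1) (τ p.1) p.2 := by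
  have hK : Measurable (fun q : ℝ × E => heatKernel q.1 q.2) := by
    unfold heatKernel
    fun_prop
  have hF : StronglyMeasurable fun r : (ℝ × E) × E => heatKernel (τ r.1.1) r.2 • g r.1.1 (r.1.2 - r.2) := by
    have g1 : Measurable fun r : (ℝ × E) × E => ((τ r.1.1, r.2) : ℝ × E) :=
      (hτ.comp measurable_fst.fst).prodMk measurable_snd
    have g2 : Measurable fun r : (ℝ × E) × E => ((r.1.1, r.1.2 - r.2) : ℝ × E) :=
      measurable_fst.fst.prodMk (measurable_fst.snd.sub measurable_snd)
    exact ((hK.comp g1).stronglyMeasurable).smul (hgm.comp_measurable g2)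
  have key : StronglyMeasurable fun p : ℝ × E => ∫ y, heatKernel (τ p.1) y • g p.1 (p.2 - y) :=
    hF.integral_prod_right' (ν := (volume : Measure E))
  have hfun : (fun p : ℝ × E => heatExtension (g p.1) (τ p.1) p.2) =
      fun p => ∫ y, heatKernel (τ p.1) y • g p.1 (p.2 - y) := by
    funext p; exact heatExtension_apply _ _ _
  rw [hfun]; exact key

omit [FiniteDimensional ℝ E] [MeasurableSpace E] [BorelSpace E] [CompleteSpace F] in
/-- **Directional derivatives of a measurable family of differentiable slices are measurable**
(difference quotients along `v` converge, `HasFDerivAt.lim`): for `φ : ℝ → E → F` with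
`uncurry φ` strongly measurable and `φ s` differentiable for `s ∈ S`, the field
`(s, y) ↦ 1_S(s) Dφ_s(y) v` is strongly measurable. [folklore] -/
theorem stronglyMeasurable_indicator_fderiv_apply [MeasurableSpace E] [BorelSpace E]
    {φ : ℝ → E → F} {S : Set ℝ} [DecidablePred (· ∈ S)] (hS : MeasurableSet S)
    (hφm : StronglyMeasurable (uncurry φ)) (hdiff : ∀ s ∈ S, Differentiable ℝ (φ s)) (v : E) :
    StronglyMeasurable fun p : ℝ × E => if p.1 ∈ S then fderiv ℝ (φ p.1) p.2 v else 0 := by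
  classical
  -- the difference quotients
  set q : ℕ → ℝ × E → F := fun n p =>
    if p.1 ∈ S then ((n : ℝ) + 1) • (φ p.1 (p.2 + ((n : ℝ) + 1)⁻¹ • v) - φ p.1 p.2) else 0 with hq
  have hSp : MeasurableSet {p : ℝ × E | p.1 ∈ S} := measurable_fst hS
  have hqm : ∀ n, StronglyMeasurable (q n) := by
    intro n
    classical
    have h1 : StronglyMeasurable fun p : ℝ × E => φ p.1 (p.2 + ((n : ℝ) + 1)⁻¹ • v) :=
      hφm.comp_measurable (measurable_fst.prodMk (measurable_snd.add_const _))
    have h2 : StronglyMeasurable fun p : ℝ × E => φ p.1 p.2 := hφm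
    have h3 : StronglyMeasurable fun p : ℝ × E => ((n : ℝ) + 1) • (φ p.1 (p.2 + ((n : ℝ) + 1)⁻¹ • v) - φ p.1 p.2) :=
      (h1.sub h2).const_smul _
    exact h3.piecewise hSp stronglyMeasurable_const
  refine stronglyMeasurable_of_tendsto atTop hqm (tendsto_pi_nhds.2 fun p => ?_)
  by_cases hp : p.1 ∈ S
  · simp only [hq, hp, if_true]
    have hd : HasFDerivAt (φ p.1) (fderiv ℝ (φ p.1) p.2) p.2 := ((hdiff p.1 hp) p.2).hasFDerivAt
    have hc : Tendsto (fun n : ℕ => ‖(n : ℝ) + 1‖) atTop atTop := by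
      have h1 : Tendsto (fun n : ℕ => (n : ℝ) + 1) atTop atTop :=
        tendsto_atTop_add_const_right _ 1 tendsto_natCast_atTop_atTop
      have h2 : ∀ n : ℕ, ‖(n : ℝ) + 1‖ = (n : ℝ) + 1 := fun n =>
        Real.norm_of_nonneg (by positivity)
      exact h1.congr fun n => (h2 n).symm
    exact hd.lim v hc
  · simp only [hq, hp, if_false]
    exact tendsto_const_nhds

omit [MeasurableSpace E] [BorelSpace E] [CompleteSpace F] in
/-- **The derivative field of a measurable family of differentiable slices is measurable**
(operator-valued form, from the directional form through an orthonormal frame: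
`L = ∑ᵢ ⟪·, bᵢ⟫ ⊗ L bᵢ`). [folklore] -/
theorem stronglyMeasurable_indicator_fderiv [MeasurableSpace E] [BorelSpace E]
    {φ : ℝ → E → F} {S : Set ℝ} [DecidablePred (· ∈ S)] (hS : MeasurableSet S)
    (hφm : StronglyMeasurable (uncurry φ)) (hdiff : ∀ s ∈ S, Differentiable ℝ (φ s)) :
    StronglyMeasurable fun p : ℝ × E => if p.1 ∈ S then fderiv ℝ (φ p.1) p.2 else 0 := by
  classical
  set b := stdOrthonormalBasis ℝ E with hb
  -- expansion of an operator in the frame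
  have hexp : ∀ L : E →L[ℝ] F, L = ∑ i, (innerSL ℝ (b i)).smulRight (L (b i)) := by
    intro L
    ext w
    simp only [_root_.sum_apply, ContinuousLinearMap.smulRight_apply, innerSL_apply_apply]
    conv_lhs => rw [← b.sum_repr' w]
    rw [map_sum]
    exact Finset.sum_congr rfl fun i _ => by rw [map_smul]
  have hfun : (fun p : ℝ × E => if p.1 ∈ S then fderiv ℝ (φ p.1) p.2 else 0) =
      fun p => ∑ i, (innerSL ℝ (b i)).smulRight (if p.1 ∈ S then fderiv ℝ (φ p.1) p.2 (b i) else 0) := by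
    funext p
    by_cases hp : p.1 ∈ S
    · simp only [hp, if_true]; exact hexp _
    · simp only [hp, if_false, ContinuousLinearMap.smulRight_zero, Finset.sum_const_zero]
  rw [hfun]
  refine Finset.stronglyMeasurable_fun_sum (Finset.univ : Finset (Fin (Module.finrank ℝ E))) fun i _ => ?_
  have hcont : Continuous fun f : F => (innerSL ℝ (b i)).smulRight f :=
    (ContinuousLinearMap.smulRightL ℝ E F (innerSL ℝ (b i))).continuous
  exact hcont.comp_stronglyMeasurable (stronglyMeasurable_indicator_fderiv_apply hS hφm hdiff (b i))

end Measurability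

/-! ## Elementary integrals `∫ (t - s)^r ds` -/

section RpowIntegrals

/-- `s ↦ (t - s)^r` is integrable on `(a, t)` for `-1 < r`. [folklore] -/
theorem integrableOn_rpow_sub {r : ℝ} (hr : -1 < r) (a t : ℝ) :
    IntegrableOn (fun s : ℝ => (t - s) ^ r) (Ioo a t) volume := by
  have h := (intervalIntegral.intervalIntegrable_rpow' (a := a) (b := t) hr).comp_sub_left t
  -- `h : IntervalIntegrable (fun s => (t - s)^r) volume (t - a) (t - t)`
  rw [sub_self] at h
  have h' : IntegrableOn (fun s : ℝ => (t - s) ^ r) (Ioc 0 (t - a)) volume := h.2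
  -- translate: not needed; instead use the interval `(a, t)` directly
  have h2 := (intervalIntegral.intervalIntegrable_rpow' (a := 0) (b := t - a) hr).comp_sub_left t
  rw [sub_zero, sub_sub_cancel] at h2
  -- `h2 : IntervalIntegrable (fun s => (t - s)^r) volume t a`
  exact (h2.2).mono_set Ioo_subset_Ioc_self

/-- `∫_{(a,t)} (t - s)^r ds = (t - a)^{r+1}/(r+1)` for `-1 < r`, `a ≤ t`. [folklore] -/
theorem setIntegral_rpow_sub {r : ℝ} (hr : -1 < r) {a t : ℝ} (hat : a ≤ t) :
    ∫ s in Ioo a t, (t - s) ^ r = (t - a) ^ (r + 1) / (r + 1) := by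
  rw [setIntegral_congr_set (Ioo_ae_eq_Ioc (α := ℝ)), ← intervalIntegral.integral_of_le hat,
    intervalIntegral.integral_comp_sub_left (fun x : ℝ => x ^ r) t, sub_self,
    integral_rpow (Or.inl hr), Real.zero_rpow (by linarith), sub_zero]

/-- Far part: `∫_{(0, t-ρ)} (t - s)^γ ds ≤ ρ^{γ+1}/(-(γ+1))` for `γ < -1`, `0 < ρ`. [folklore] -/
theorem setIntegral_rpow_sub_far_le {γ : ℝ} (hγ : γ < -1) {ρ t : ℝ} (hρ : 0 < ρ) :
    ∫ s in Ioo 0 (t - ρ), (t - s) ^ γ ≤ ρ ^ (γ + 1) / (-(γ + 1)) := by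
  have hγ1 : γ + 1 < 0 := by linarith
  have hρpow : 0 ≤ ρ ^ (γ + 1) := Real.rpow_nonneg hρ.le _
  by_cases hρt : ρ ≤ t
  · have h0 : (0 : ℝ) ≤ t - ρ := by linarith
    have hnot : (0 : ℝ) ∉ uIcc ρ t := by
      rw [uIcc_of_le hρt]
      exact fun h => (lt_irrefl (0 : ℝ)) (hρ.trans_le h.1)
    rw [setIntegral_congr_set (Ioo_ae_eq_Ioc (α := ℝ)), ← intervalIntegral.integral_of_le h0,
      intervalIntegral.integral_comp_sub_left (fun x : ℝ => x ^ γ) t, sub_zero, sub_sub_cancel,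
      integral_rpow (Or.inr ⟨by linarith, hnot⟩)]
    have ht : 0 ≤ t ^ (γ + 1) := Real.rpow_nonneg (by linarith) _
    -- `(t^{γ+1} - ρ^{γ+1})/(γ+1) ≤ -ρ^{γ+1}/(γ+1) = ρ^{γ+1}/(-(γ+1))`
    have e1 : (t ^ (γ + 1) - ρ ^ (γ + 1)) / (γ + 1) = (ρ ^ (γ + 1) - t ^ (γ + 1)) / (-(γ + 1)) := by
      rw [div_neg, ← neg_div, neg_sub]
    rw [e1]
    exact div_le_div_of_nonneg_right (by linarith) (by linarith)
  · push Not at hρt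
    have he : Ioo (0 : ℝ) (t - ρ) = ∅ := Ioo_eq_empty fun h => by linarith
    rw [he, Measure.restrict_empty, integral_zero_measure]
    exact div_nonneg hρpow (by linarith)

end RpowIntegrals

/-! ## The slice Duhamel integral `J[g](t, x) = ∫₀ᵗ e^{(t-s)Δ} g(s) (x) ds` of bounded data -/

section Duhamel

variable {g : ℝ → E → F} {t C : ℝ}

omit [CompleteSpace F] in
/-- The caloric lifts `(s, y) ↦ e^{(t-s)Δ}g(s)(y)` are jointly strongly measurable. [folklore] -/
theorem stronglyMeasurable_lift (hgm : StronglyMeasurable (uncurry g)) (t : ℝ) :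
    StronglyMeasurable (uncurry fun s y => heatExtension (g s) (t - s) y) :=
  stronglyMeasurable_heatExtension_slice hgm (measurable_const.sub measurable_id)

/-- The lifts `e^{(t-s)Δ}g(s)` are smooth for `s < t` (bounded continuous data). [folklore] -/
theorem contDiff_lift (hgc : ∀ s, Continuous (g s)) (hgC : ∀ s y, ‖g s y‖ ≤ C) {s : ℝ} (hs : s < t)
    {m : ℕ∞} : ContDiff ℝ m (heatExtension (g s) (t - s)) :=
  contDiff_heatExtension_of_bound (hgc s) (hgC s) (sub_pos.2 hs)

omit [CompleteSpace F] in
/-- Measurability in `s` of the lift at a point. [folklore] -/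
theorem aestronglyMeasurable_lift_apply (hgm : StronglyMeasurable (uncurry g)) (t : ℝ) (x : E)
    (μ : Measure ℝ) : AEStronglyMeasurable (fun s => heatExtension (g s) (t - s) x) μ :=
  ((stronglyMeasurable_lift hgm t).comp_measurable (measurable_id.prodMk measurable_const)).aestronglyMeasurable

/-- Measurability in `s ∈ (0,t)` of the derivative of the lift at a point. [folklore] -/
theorem aestronglyMeasurable_fderiv_lift_apply (hgm : StronglyMeasurable (uncurry g))
    (hgc : ∀ s, Continuous (g s)) (hgC : ∀ s y, ‖g s y‖ ≤ C) (t : ℝ) (x : E) :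
    AEStronglyMeasurable (fun s => fderiv ℝ (heatExtension (g s) (t - s)) x) (volume.restrict (Ioo 0 t)) := by
  classical
  have hΨ := stronglyMeasurable_indicator_fderiv (S := Iio t) measurableSet_Iio (stronglyMeasurable_lift hgm t)
    (fun s hs => (contDiff_lift hgc hgC (m := 1) hs).differentiable one_ne_zero)
  have hsec : StronglyMeasurable fun s => (if s ∈ Iio t then fderiv ℝ (heatExtension (g s) (t - s)) x else 0) :=
    hΨ.comp_measurable (measurable_id.prodMk measurable_const)
  refine hsec.aestronglyMeasurable.congr ?_
  filter_upwards [ae_restrict_mem measurableSet_Ioo] with s hs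
  rw [if_pos (show s ∈ Iio t from hs.2)]

/-- The derivative lifts `(s, y) ↦ 1_{s<t} D(e^{(t-s)Δ}g(s))(y)` form again a strongly measurable family
of slices, differentiable for `s < t` (so that the measurability lemmas iterate). [folklore] -/
theorem stronglyMeasurable_fderiv_lift (hgm : StronglyMeasurable (uncurry g))
    (hgc : ∀ s, Continuous (g s)) (hgC : ∀ s y, ‖g s y‖ ≤ C) (t : ℝ) :
    StronglyMeasurable (uncurry fun s y =>
      if s ∈ Iio t then fderiv ℝ (heatExtension (g s) (t - s)) y else 0) := by
  classical
  exact stronglyMeasurable_indicator_fderiv (S := Iio t) measurableSet_Iio (stronglyMeasurable_lift hgm t)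
    (fun s hs => (contDiff_lift hgc hgC (m := 1) hs).differentiable one_ne_zero)

/-- Measurability in `s ∈ (0,t)` of the second derivative of the lift at a point. [folklore] -/
theorem aestronglyMeasurable_fderiv_fderiv_lift_apply (hgm : StronglyMeasurable (uncurry g))
    (hgc : ∀ s, Continuous (g s)) (hgC : ∀ s y, ‖g s y‖ ≤ C) (t : ℝ) (x : E) :
    AEStronglyMeasurable (fun s => fderiv ℝ (fderiv ℝ (heatExtension (g s) (t - s))) x)
      (volume.restrict (Ioo 0 t)) := by
  classical
  set φ₁ : ℝ → E → E →L[ℝ] F := fun s y =>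
    if s ∈ Iio t then fderiv ℝ (heatExtension (g s) (t - s)) y else 0 with hφ₁
  have hφ₁m : StronglyMeasurable (uncurry φ₁) := stronglyMeasurable_fderiv_lift hgm hgc hgC t
  have hφ₁d : ∀ s ∈ Iio t, Differentiable ℝ (φ₁ s) := by
    intro s hs
    have : φ₁ s = fderiv ℝ (heatExtension (g s) (t - s)) := by
      funext y; simp [hφ₁, show s < t from hs]
    rw [this]
    exact ((contDiff_lift hgc hgC (m := 2) hs).fderiv_right (m := 1) (by norm_cast)).differentiable one_ne_zero
  have hΨ := stronglyMeasurable_indicator_fderiv (S := Iio t) measurableSet_Iio hφ₁m hφ₁d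
  have hsec : StronglyMeasurable fun s => (if s ∈ Iio t then fderiv ℝ (φ₁ s) x else 0) :=
    hΨ.comp_measurable (measurable_id.prodMk measurable_const)
  refine hsec.aestronglyMeasurable.congr ?_
  filter_upwards [ae_restrict_mem measurableSet_Ioo] with s hs
  rw [if_pos (show s ∈ Iio t from hs.2)]
  have : φ₁ s = fderiv ℝ (heatExtension (g s) (t - s)) := by
    funext y; simp [hφ₁, hs.2]
  rw [this]

/-- The volume of `(0, t)`. [folklore] -/
theorem volume_real_Ioo {t : ℝ} (ht : 0 ≤ t) : (volume : Measure ℝ).real (Ioo (0 : ℝ) t) = t := by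
  rw [measureReal_def, Real.volume_Ioo, sub_zero, ENNReal.toReal_ofReal ht]

omit [CompleteSpace F] in
/-- Integrability in `s ∈ (0,t)` of the lift at a point (bounded data). [folklore] -/
theorem integrableOn_lift_apply (hgm : StronglyMeasurable (uncurry g))
    (hgC : ∀ s y, ‖g s y‖ ≤ C) (t : ℝ) (x : E) :
    IntegrableOn (fun s => heatExtension (g s) (t - s) x) (Ioo 0 t) volume := by
  refine Measure.integrableOn_of_bounded (M := C) (measure_Ioo_lt_top (μ := (volume : Measure ℝ))).ne
    (aestronglyMeasurable_lift_apply hgm t x _) ?_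
  filter_upwards [ae_restrict_mem measurableSet_Ioo] with s hs
  exact norm_heatExtension_le_of_bound (hgC s) (sub_pos.2 hs.2) x

omit [CompleteSpace F] in
/-- **Sup bound** `‖J[g](t, x)‖ ≤ C t`. [folklore] -/
theorem norm_duhamel_le (hgC : ∀ s y, ‖g s y‖ ≤ C) (ht : 0 ≤ t) (x : E) :
    ‖∫ s in Ioo 0 t, heatExtension (g s) (t - s) x‖ ≤ C * t := by
  have h := norm_setIntegral_le_of_norm_le_const (measure_Ioo_lt_top (μ := (volume : Measure ℝ)) (a := 0) (b := t))
    (fun s hs => norm_heatExtension_le_of_bound (hgC s) (sub_pos.2 hs.2) x)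
    (f := fun s => heatExtension (g s) (t - s) x)
  rwa [volume_real_Ioo ht] at h

/-- **Differentiation under the Duhamel integral** (bounded continuous data): `x ↦ J[g](t, x)` has
derivative `∫₀ᵗ D(e^{(t-s)Δ}g(s))(x) ds`, the integrand being dominated by `2^{d/2} C (t-s)^{-1/2}`.
[folklore] -/
theorem hasFDerivAt_duhamel (hgm : StronglyMeasurable (uncurry g)) (hgc : ∀ s, Continuous (g s))
    (hgC : ∀ s y, ‖g s y‖ ≤ C) (t : ℝ) (x : E) :
    HasFDerivAt (fun x => ∫ s in Ioo 0 t, heatExtension (g s) (t - s) x)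
      (∫ s in Ioo 0 t, fderiv ℝ (heatExtension (g s) (t - s)) x) x := by
  set c : ℝ := (2 : ℝ) ^ ((Module.finrank ℝ E : ℝ) / 2) with hc
  refine hasFDerivAt_integral_of_dominated_of_fderiv_le (μ := volume.restrict (Ioo 0 t))
    (F := fun x s => heatExtension (g s) (t - s) x)
    (F' := fun x s => fderiv ℝ (heatExtension (g s) (t - s)) x)
    (bound := fun s => c * (t - s) ^ (-(1 / 2 : ℝ)) * C) (ball_mem_nhds x zero_lt_one) ?_ ?_ ?_ ?_ ?_ ?_
  · exact Eventually.of_forall fun x' => aestronglyMeasurable_lift_apply hgm t x' _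
  · exact integrableOn_lift_apply hgm hgC t x
  · exact aestronglyMeasurable_fderiv_lift_apply hgm hgc hgC t x
  · filter_upwards [ae_restrict_mem measurableSet_Ioo] with s hs x' _
    exact norm_fderiv_heatExtension_le_of_bounded (hgc s).aestronglyMeasurable (hgC s) (sub_pos.2 hs.2) x'
  · have h := ((integrableOn_rpow_sub (r := -(1 / 2 : ℝ)) (by norm_num) 0 t).const_mul c).mul_const C
    exact h
  · filter_upwards [ae_restrict_mem measurableSet_Ioo] with s hs x' _
    exact (((contDiff_lift hgc hgC (m := 1) hs.2).differentiable one_ne_zero) x').hasFDerivAt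

/-- **Gradient bound** `‖DJ[g](t, x)‖ ≤ 2 · 2^{d/2} C √t`. [folklore] -/
theorem norm_fderiv_duhamel_le (hgm : StronglyMeasurable (uncurry g)) (hgc : ∀ s, Continuous (g s))
    (hgC : ∀ s y, ‖g s y‖ ≤ C) (ht : 0 < t) (x : E) :
    ‖fderiv ℝ (fun x => ∫ s in Ioo 0 t, heatExtension (g s) (t - s) x) x‖ ≤
      2 * (2 : ℝ) ^ ((Module.finrank ℝ E : ℝ) / 2) * C * t ^ (1 / 2 : ℝ) := by
  set c : ℝ := (2 : ℝ) ^ ((Module.finrank ℝ E : ℝ) / 2) with hc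
  rw [(hasFDerivAt_duhamel hgm hgc hgC t x).fderiv]
  have hC0 : 0 ≤ C := (norm_nonneg _).trans (hgC 0 0)
  have hint : IntegrableOn (fun s : ℝ => c * (t - s) ^ (-(1 / 2 : ℝ)) * C) (Ioo 0 t) volume :=
    ((integrableOn_rpow_sub (r := -(1 / 2 : ℝ)) (by norm_num) 0 t).const_mul c).mul_const C
  calc ‖∫ s in Ioo 0 t, fderiv ℝ (heatExtension (g s) (t - s)) x‖
      ≤ ∫ s in Ioo 0 t, c * (t - s) ^ (-(1 / 2 : ℝ)) * C := by
        refine norm_integral_le_of_norm_le hint ?_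
        filter_upwards [ae_restrict_mem measurableSet_Ioo] with s hs
        exact norm_fderiv_heatExtension_le_of_bounded (hgc s).aestronglyMeasurable (hgC s) (sub_pos.2 hs.2) x
    _ = c * C * ∫ s in Ioo 0 t, (t - s) ^ (-(1 / 2 : ℝ)) := by
        rw [← integral_const_mul]
        exact integral_congr_ae (Eventually.of_forall fun s => by ring)
    _ = 2 * c * C * t ^ (1 / 2 : ℝ) := by
        rw [setIntegral_rpow_sub (by norm_num) ht.le, sub_zero]
        norm_num
        ring

omit [InnerProductSpace ℝ E] [FiniteDimensional ℝ E] [MeasurableSpace E] [BorelSpace E] [CompleteSpace F] in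
/-- `‖D(Df)(x)‖ = ‖D²f(x)‖` and `‖D(D(Df))(x)‖ = ‖D³f(x)‖` (currying isometries). [folklore] -/
theorem norm_fderiv_fderiv_eq {E' : Type*} [NormedAddCommGroup E'] [NormedSpace ℝ E'] (f : E' → F) (x : E') :
    ‖fderiv ℝ (fderiv ℝ f) x‖ = ‖iteratedFDeriv ℝ 2 f x‖ := by
  rw [← norm_iteratedFDeriv_one (𝕜 := ℝ) (fderiv ℝ f), norm_iteratedFDeriv_fderiv]

omit [InnerProductSpace ℝ E] [FiniteDimensional ℝ E] [MeasurableSpace E] [BorelSpace E] [CompleteSpace F] in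
/-- Mean value inequality for `D²f`: `‖D(Df)(x) - D(Df)(x')‖ ≤ sup ‖D³f‖ ‖x - x'‖`, `f ∈ C³`. [folklore] -/
theorem norm_fderiv_fderiv_sub_le {E' : Type*} [NormedAddCommGroup E'] [NormedSpace ℝ E']
    {f : E' → F} (hf : ContDiff ℝ 3 f) {B : ℝ} (hB : ∀ y, ‖iteratedFDeriv ℝ 3 f y‖ ≤ B) (x x' : E') :
    ‖fderiv ℝ (fderiv ℝ f) x - fderiv ℝ (fderiv ℝ f) x'‖ ≤ B * ‖x - x'‖ := by
  have hd : Differentiable ℝ (fderiv ℝ (fderiv ℝ f)) :=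
    (((hf.fderiv_right (m := 2) (by norm_cast)).fderiv_right (m := 1) (by norm_cast)).differentiable one_ne_zero)
  have hbound : ∀ y, ‖fderiv ℝ (fderiv ℝ (fderiv ℝ f)) y‖ ≤ B := fun y => by
    rw [← norm_iteratedFDeriv_one (𝕜 := ℝ) (fderiv ℝ (fderiv ℝ f)), norm_iteratedFDeriv_fderiv,
      norm_iteratedFDeriv_fderiv]
    exact hB y
  exact Convex.norm_image_sub_le_of_norm_fderiv_le (fun y _ => hd y) (fun y _ => hbound y)
    convex_univ (mem_univ x') (mem_univ x)

omit [FiniteDimensional ℝ E] [MeasurableSpace E] [BorelSpace E] in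
/-- The constant `K₂(d) = 4·2^{d/2}·(2·2^{d/2}(1 + 2·2^{d/2}))` of the two-derivative bound is
nonnegative. [folklore] -/
theorem K2_nonneg : 0 ≤ (4 * (2 : ℝ) ^ ((Module.finrank ℝ E : ℝ) / 2) *
    (2 * (2 : ℝ) ^ ((Module.finrank ℝ E : ℝ) / 2) * (1 + 2 * (2 : ℝ) ^ ((Module.finrank ℝ E : ℝ) / 2)))) := by
  positivity

/-- **Second differentiation under the Duhamel integral on Hölder data**: if moreover the slices
are uniformly `β`-Hölder, `‖g(s,y) - g(s,z)‖ ≤ A‖y - z‖^β` with `0 < β ≤ 1`, then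
`x ↦ ∫₀ᵗ D(e^{(t-s)Δ}g(s))(x) ds` has derivative `∫₀ᵗ D²(e^{(t-s)Δ}g(s))(x) ds`, the integrand being
dominated by `K₂ A (t-s)^{(β-2)/2}` (integrable since `β > 0`). [folklore] -/
theorem hasFDerivAt_fderiv_duhamel (hgm : StronglyMeasurable (uncurry g)) (hgc : ∀ s, Continuous (g s))
    (hgC : ∀ s y, ‖g s y‖ ≤ C) {A β : ℝ} (hA : 0 ≤ A) (hβ0 : 0 < β) (hβ1 : β ≤ 1)
    (hgA : ∀ s y z, ‖g s y - g s z‖ ≤ A * ‖y - z‖ ^ β) (t : ℝ) (x : E) :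
    HasFDerivAt (fun x => ∫ s in Ioo 0 t, fderiv ℝ (heatExtension (g s) (t - s)) x)
      (∫ s in Ioo 0 t, fderiv ℝ (fderiv ℝ (heatExtension (g s) (t - s))) x) x := by
  set c : ℝ := (2 : ℝ) ^ ((Module.finrank ℝ E : ℝ) / 2) with hc
  set K₂ : ℝ := 4 * c * (2 * c * (1 + 2 * c)) with hK₂
  refine hasFDerivAt_integral_of_dominated_of_fderiv_le (μ := volume.restrict (Ioo 0 t))
    (F := fun x s => fderiv ℝ (heatExtension (g s) (t - s)) x)
    (F' := fun x s => fderiv ℝ (fderiv ℝ (heatExtension (g s) (t - s))) x)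
    (bound := fun s => K₂ * A * (t - s) ^ ((β - 2) / 2)) (ball_mem_nhds x zero_lt_one) ?_ ?_ ?_ ?_ ?_ ?_
  · exact Eventually.of_forall fun x' => aestronglyMeasurable_fderiv_lift_apply hgm hgc hgC t x'
  · have hb : IntegrableOn (fun s : ℝ => c * (t - s) ^ (-(1 / 2 : ℝ)) * C) (Ioo 0 t) volume :=
      ((integrableOn_rpow_sub (r := -(1 / 2 : ℝ)) (by norm_num) 0 t).const_mul c).mul_const C
    refine hb.mono' (aestronglyMeasurable_fderiv_lift_apply hgm hgc hgC t x) ?_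
    filter_upwards [ae_restrict_mem measurableSet_Ioo] with s hs
    exact norm_fderiv_heatExtension_le_of_bounded (hgc s).aestronglyMeasurable (hgC s) (sub_pos.2 hs.2) x
  · exact aestronglyMeasurable_fderiv_fderiv_lift_apply hgm hgc hgC t x
  · filter_upwards [ae_restrict_mem measurableSet_Ioo] with s hs x' _
    rw [norm_fderiv_fderiv_eq]
    exact norm_iteratedFDeriv_two_heatExtension_le_holder (hgc s) (hgC s) hA hβ0.le hβ1 (hgA s) (sub_pos.2 hs.2) x'
  · exact ((integrableOn_rpow_sub (r := (β - 2) / 2) (by linarith) 0 t).const_mul (K₂ * A))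
  · filter_upwards [ae_restrict_mem measurableSet_Ioo] with s hs x' _
    exact ((((contDiff_lift hgc hgC (m := 2) hs.2).fderiv_right (m := 1) (by norm_cast)).differentiable
      one_ne_zero) x').hasFDerivAt

/-- **Bound on the second derivative of the Duhamel integral of Hölder data**:
`‖∫₀ᵗ D²(e^{(t-s)Δ}g(s))(x) ds‖ ≤ K₂ A (2/β) t^{β/2}`. [folklore] -/
theorem norm_fderiv_fderiv_duhamel_le (hgc : ∀ s, Continuous (g s))
    (hgC : ∀ s y, ‖g s y‖ ≤ C) {A β : ℝ} (hA : 0 ≤ A) (hβ0 : 0 < β) (hβ1 : β ≤ 1)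
    (hgA : ∀ s y z, ‖g s y - g s z‖ ≤ A * ‖y - z‖ ^ β) (ht : 0 < t) (x : E) :
    ‖∫ s in Ioo 0 t, fderiv ℝ (fderiv ℝ (heatExtension (g s) (t - s))) x‖ ≤
      (4 * (2 : ℝ) ^ ((Module.finrank ℝ E : ℝ) / 2) *
        (2 * (2 : ℝ) ^ ((Module.finrank ℝ E : ℝ) / 2) * (1 + 2 * (2 : ℝ) ^ ((Module.finrank ℝ E : ℝ) / 2)))) *
        A * (2 / β) * t ^ (β / 2) := by
  set c : ℝ := (2 : ℝ) ^ ((Module.finrank ℝ E : ℝ) / 2) with hc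
  set K₂ : ℝ := 4 * c * (2 * c * (1 + 2 * c)) with hK₂
  have hK₂0 : 0 ≤ K₂ := by positivity
  have hint : IntegrableOn (fun s : ℝ => K₂ * A * (t - s) ^ ((β - 2) / 2)) (Ioo 0 t) volume :=
    (integrableOn_rpow_sub (r := (β - 2) / 2) (by linarith) 0 t).const_mul (K₂ * A)
  calc ‖∫ s in Ioo 0 t, fderiv ℝ (fderiv ℝ (heatExtension (g s) (t - s))) x‖
      ≤ ∫ s in Ioo 0 t, K₂ * A * (t - s) ^ ((β - 2) / 2) := by
        refine norm_integral_le_of_norm_le hint ?_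
        filter_upwards [ae_restrict_mem measurableSet_Ioo] with s hs
        rw [norm_fderiv_fderiv_eq]
        exact norm_iteratedFDeriv_two_heatExtension_le_holder (hgc s) (hgC s) hA hβ0.le hβ1 (hgA s)
          (sub_pos.2 hs.2) x
    _ = K₂ * A * ∫ s in Ioo 0 t, (t - s) ^ ((β - 2) / 2) := integral_const_mul _ _
    _ = K₂ * A * (2 / β) * t ^ (β / 2) := by
        rw [setIntegral_rpow_sub (by linarith) ht.le, sub_zero,
          show (β - 2) / 2 + 1 = β / 2 by ring]
        field_simp

/-- **Hölder continuity of the second derivative of the Duhamel integral of Hölder data**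
(`0 < β < 1`): `‖∫₀ᵗ D²(e^{(t-s)Δ}g(s))(x) ds - ∫₀ᵗ D²(e^{(t-s)Δ}g(s))(x') ds‖ ≤ M A ‖x - x'‖^β` with
`M = 4K₂/β + 2K₃/(1-β)`: the integrand difference is at most `2K₂A(t-s)^{(β-2)/2}` (always) and at
most `K₃A(t-s)^{(β-3)/2}‖x - x'‖` (mean value), and one uses the first bound for `t - s < ‖x-x'‖²`,
the second otherwise. [folklore] -/
theorem norm_fderiv_fderiv_duhamel_sub_le (hgm : StronglyMeasurable (uncurry g))
    (hgc : ∀ s, Continuous (g s))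
    (hgC : ∀ s y, ‖g s y‖ ≤ C) {A β : ℝ} (hA : 0 ≤ A) (hβ0 : 0 < β) (hβ1 : β < 1)
    (hgA : ∀ s y z, ‖g s y - g s z‖ ≤ A * ‖y - z‖ ^ β) (ht : 0 < t) (x x' : E) :
    ‖(∫ s in Ioo 0 t, fderiv ℝ (fderiv ℝ (heatExtension (g s) (t - s))) x) -
        ∫ s in Ioo 0 t, fderiv ℝ (fderiv ℝ (heatExtension (g s) (t - s))) x'‖ ≤
      ((4 / β) * (4 * (2 : ℝ) ^ ((Module.finrank ℝ E : ℝ) / 2) *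
          (2 * (2 : ℝ) ^ ((Module.finrank ℝ E : ℝ) / 2) * (1 + 2 * (2 : ℝ) ^ ((Module.finrank ℝ E : ℝ) / 2)))) +
        (2 / (1 - β)) * (4 * (2 : ℝ) ^ ((Module.finrank ℝ E : ℝ) / 2) * (4 * (2 : ℝ) ^ ((Module.finrank ℝ E : ℝ) / 2) *
          (2 * (2 : ℝ) ^ ((Module.finrank ℝ E : ℝ) / 2) * (1 + 2 * (2 : ℝ) ^ ((Module.finrank ℝ E : ℝ) / 2)))))) *
        A * ‖x - x'‖ ^ β := by
  set c : ℝ := (2 : ℝ) ^ ((Module.finrank ℝ E : ℝ) / 2) with hc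
  set K₂ : ℝ := 4 * c * (2 * c * (1 + 2 * c)) with hK₂
  set K₃ : ℝ := 4 * c * K₂ with hK₃
  have hK₂0 : 0 ≤ K₂ := by positivity
  have hK₃0 : 0 ≤ K₃ := by positivity
  set r : ℝ := ‖x - x'‖ with hr
  have hr0 : 0 ≤ r := norm_nonneg _
  -- the integrands and their difference
  set Φ : E → ℝ → E →L[ℝ] E →L[ℝ] F := fun y s => fderiv ℝ (fderiv ℝ (heatExtension (g s) (t - s))) y with hΦ
  -- trivial case `x = x'`
  rcases hr0.eq_or_lt with hr00 | hrpos
  · have hxx : x = x' := by rwa [eq_comm, hr, norm_sub_eq_zero_iff] at hr00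
    subst hxx
    rw [sub_self, norm_zero, ← hr00, Real.zero_rpow hβ0.ne', mul_zero]
  set ρ : ℝ := r ^ 2 with hρ
  have hρ0 : 0 < ρ := by positivity
  -- integrability of the integrands
  have hint : ∀ y, IntegrableOn (fun s => Φ y s) (Ioo 0 t) volume := by
    intro y
    have hb : IntegrableOn (fun s : ℝ => K₂ * A * (t - s) ^ ((β - 2) / 2)) (Ioo 0 t) volume :=
      (integrableOn_rpow_sub (r := (β - 2) / 2) (by linarith) 0 t).const_mul (K₂ * A)
    refine hb.mono' (aestronglyMeasurable_fderiv_fderiv_lift_apply hgm hgc hgC t y) ?_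
    filter_upwards [ae_restrict_mem measurableSet_Ioo] with s hs
    rw [hΦ, norm_fderiv_fderiv_eq]
    exact norm_iteratedFDeriv_two_heatExtension_le_holder (hgc s) (hgC s) hA hβ0.le hβ1.le (hgA s)
      (sub_pos.2 hs.2) y
  -- the two majorants
  set f₁ : ℝ → ℝ := (Ioi (t - ρ)).indicator fun s => 2 * (K₂ * A) * (t - s) ^ ((β - 2) / 2) with hf₁
  set f₂ : ℝ → ℝ := (Iic (t - ρ)).indicator fun s => K₃ * A * r * (t - s) ^ ((β - 3) / 2) with hf₂
  have hptw : ∀ s ∈ Ioo 0 t, ‖Φ x s - Φ x' s‖ ≤ f₁ s + f₂ s := by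
    intro s hs
    have hσ : 0 < t - s := sub_pos.2 hs.2
    have h2 : ∀ y, ‖Φ y s‖ ≤ K₂ * A * (t - s) ^ ((β - 2) / 2) := fun y => by
      rw [hΦ, norm_fderiv_fderiv_eq]
      exact norm_iteratedFDeriv_two_heatExtension_le_holder (hgc s) (hgC s) hA hβ0.le hβ1.le (hgA s) hσ y
    have h3 : ∀ y, ‖iteratedFDeriv ℝ 3 (heatExtension (g s) (t - s)) y‖ ≤ K₃ * A * (t - s) ^ ((β - 3) / 2) :=
      fun y => norm_iteratedFDeriv_three_heatExtension_le_holder (hgc s) (hgC s) hA hβ0.le hβ1.le (hgA s) hσ y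
    by_cases hcase : t - ρ < s
    · -- near the diagonal: triangle inequality
      have e1 : f₁ s = 2 * (K₂ * A) * (t - s) ^ ((β - 2) / 2) := by rw [hf₁, indicator_of_mem (show s ∈ Ioi (t - ρ) from hcase)]
      have e2 : f₂ s = 0 := by
        rw [hf₂, indicator_of_notMem]; exact fun h => (not_le.2 hcase) h
      rw [e1, e2, add_zero]
      calc ‖Φ x s - Φ x' s‖ ≤ ‖Φ x s‖ + ‖Φ x' s‖ := norm_sub_le _ _
        _ ≤ K₂ * A * (t - s) ^ ((β - 2) / 2) + K₂ * A * (t - s) ^ ((β - 2) / 2) := add_le_add (h2 x) (h2 x')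
        _ = 2 * (K₂ * A) * (t - s) ^ ((β - 2) / 2) := by ring
    · -- off the diagonal: mean value
      push Not at hcase
      have e1 : f₁ s = 0 := by
        rw [hf₁, indicator_of_notMem]; exact fun h => (not_lt.2 hcase) h
      have e2 : f₂ s = K₃ * A * r * (t - s) ^ ((β - 3) / 2) := by
        rw [hf₂, indicator_of_mem (show s ∈ Iic (t - ρ) from hcase)]
      rw [e1, e2, zero_add]
      have hmv := norm_fderiv_fderiv_sub_le (contDiff_lift hgc hgC (m := 3) hs.2) h3 x x'
      calc ‖Φ x s - Φ x' s‖ ≤ K₃ * A * (t - s) ^ ((β - 3) / 2) * ‖x - x'‖ := hmv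
        _ = K₃ * A * r * (t - s) ^ ((β - 3) / 2) := by rw [hr]; ring
  -- integrability of the majorants
  have hf₁i : IntegrableOn f₁ (Ioo 0 t) volume :=
    (((integrableOn_rpow_sub (r := (β - 2) / 2) (by linarith) 0 t).const_mul (2 * (K₂ * A))).indicator
      measurableSet_Ioi)
  have hf₂m : Measurable fun s : ℝ => K₃ * A * r * (t - s) ^ ((β - 3) / 2) := by fun_prop
  have hf₂i : IntegrableOn f₂ (Ioo 0 t) volume := by
    -- on `(0,t) ∩ (-∞, t-ρ]` the power `(t-s)^{(β-3)/2}` is bounded by `ρ^{(β-3)/2}`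
    refine Measure.integrableOn_of_bounded (M := K₃ * A * r * ρ ^ ((β - 3) / 2))
      (measure_Ioo_lt_top (μ := (volume : Measure ℝ))).ne
      (hf₂m.indicator measurableSet_Iic).aestronglyMeasurable ?_
    filter_upwards [ae_restrict_mem measurableSet_Ioo] with s hs
    have hσ : 0 < t - s := sub_pos.2 hs.2
    by_cases hcase : s ≤ t - ρ
    · rw [hf₂, indicator_of_mem (show s ∈ Iic (t - ρ) from hcase),
        Real.norm_of_nonneg (mul_nonneg (by positivity) (Real.rpow_nonneg hσ.le _))]
      refine mul_le_mul_of_nonneg_left ?_ (by positivity)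
      exact Real.rpow_le_rpow_of_nonpos hρ0 (by linarith) (by linarith)
    · rw [hf₂, indicator_of_notMem (show s ∉ Iic (t - ρ) from hcase), norm_zero]
      exact mul_nonneg (by positivity) (Real.rpow_nonneg hρ0.le _)
  -- the two integrals
  have hrβ : ρ ^ (β / 2) = r ^ β := by
    rw [hρ, ← Real.rpow_natCast r 2, ← Real.rpow_mul hr0]
    congr 1; push_cast; ring
  have hI₁ : ∫ s in Ioo 0 t, f₁ s ≤ (4 / β) * K₂ * A * r ^ β := by
    set m : ℝ := max 0 (t - ρ) with hm
    have hmt : m ≤ t := max_le ht.le (by linarith)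
    have htm : t - m ≤ ρ := by
      have : t - ρ ≤ m := le_max_right _ _
      linarith
    have htm0 : 0 ≤ t - m := by linarith
    rw [hf₁, setIntegral_indicator measurableSet_Ioi, Ioo_inter_Ioi, integral_const_mul,
      setIntegral_rpow_sub (by linarith) hmt, show (β - 2) / 2 + 1 = β / 2 by ring]
    have hpow : (t - m) ^ (β / 2) ≤ r ^ β := by
      rw [← hrβ]
      exact Real.rpow_le_rpow htm0 htm (by linarith)
    have hK : 0 ≤ 2 * (K₂ * A) := by positivity
    calc 2 * (K₂ * A) * ((t - m) ^ (β / 2) / (β / 2))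
        ≤ 2 * (K₂ * A) * (r ^ β / (β / 2)) := by
          refine mul_le_mul_of_nonneg_left ?_ hK
          exact div_le_div_of_nonneg_right hpow (by positivity)
      _ = (4 / β) * K₂ * A * r ^ β := by
          field_simp
          ring
  have hI₂ : ∫ s in Ioo 0 t, f₂ s ≤ (2 / (1 - β)) * K₃ * A * r ^ β := by
    rw [hf₂, setIntegral_indicator measurableSet_Iic, integral_const_mul]
    -- enlarge the domain to `(0, t - ρ]`, where the integrand is nonnegative and bounded
    have hsub : Ioo 0 t ∩ Iic (t - ρ) ⊆ Ioc 0 (t - ρ) := fun s hs => ⟨hs.1.1, hs.2⟩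
    have hIoc : IntegrableOn (fun s : ℝ => (t - s) ^ ((β - 3) / 2)) (Ioc 0 (t - ρ)) volume := by
      refine Measure.integrableOn_of_bounded (M := ρ ^ ((β - 3) / 2))
        (measure_Ioc_lt_top (μ := (volume : Measure ℝ))).ne
        ((by fun_prop : Measurable fun s : ℝ => (t - s) ^ ((β - 3) / 2)).aestronglyMeasurable) ?_
      filter_upwards [ae_restrict_mem measurableSet_Ioc] with s hs
      have hσ : ρ ≤ t - s := by linarith [hs.2]
      rw [Real.norm_of_nonneg (Real.rpow_nonneg (hρ0.le.trans hσ) _)]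
      exact Real.rpow_le_rpow_of_nonpos hρ0 hσ (by linarith)
    have hmono : ∫ s in Ioo 0 t ∩ Iic (t - ρ), (t - s) ^ ((β - 3) / 2) ≤
        ∫ s in Ioc 0 (t - ρ), (t - s) ^ ((β - 3) / 2) := by
      refine setIntegral_mono_set hIoc ?_ (Eventually.of_forall hsub)
      filter_upwards [ae_restrict_mem measurableSet_Ioc] with s hs
      exact Real.rpow_nonneg (by linarith [hs.2, hρ0.le]) _
    have hfar : ∫ s in Ioc 0 (t - ρ), (t - s) ^ ((β - 3) / 2) ≤ ρ ^ ((β - 3) / 2 + 1) / (-((β - 3) / 2 + 1)) := by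
      rw [← setIntegral_congr_set (Ioo_ae_eq_Ioc (α := ℝ))]
      exact setIntegral_rpow_sub_far_le (by linarith) hρ0
    have hρpow : ρ ^ ((β - 3) / 2 + 1) = r ^ (β - 1) := by
      rw [hρ, ← Real.rpow_natCast r 2, ← Real.rpow_mul hr0]
      congr 1; push_cast; ring
    have hK : 0 ≤ K₃ * A * r := by positivity
    calc K₃ * A * r * ∫ s in Ioo 0 t ∩ Iic (t - ρ), (t - s) ^ ((β - 3) / 2)
        ≤ K₃ * A * r * (ρ ^ ((β - 3) / 2 + 1) / (-((β - 3) / 2 + 1))) :=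
          mul_le_mul_of_nonneg_left (hmono.trans hfar) hK
      _ = K₃ * A * (r * r ^ (β - 1)) * (2 / (1 - β)) := by
          rw [hρpow]
          have h1 : -((β - 3) / 2 + 1) = (1 - β) / 2 := by ring
          rw [h1]
          field_simp
      _ = (2 / (1 - β)) * K₃ * A * r ^ β := by
          rw [show r * r ^ (β - 1) = r ^ β by
            rw [← Real.rpow_one_add' hr0 (by linarith), add_sub_cancel]]
          ring
  -- conclusion
  calc ‖(∫ s in Ioo 0 t, Φ x s) - ∫ s in Ioo 0 t, Φ x' s‖
      = ‖∫ s in Ioo 0 t, (Φ x s - Φ x' s)‖ := by rw [integral_sub (hint x) (hint x')]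
    _ ≤ ∫ s in Ioo 0 t, (f₁ s + f₂ s) := by
        refine norm_integral_le_of_norm_le (hf₁i.add hf₂i) ?_
        filter_upwards [ae_restrict_mem measurableSet_Ioo] with s hs
        exact hptw s hs
    _ = (∫ s in Ioo 0 t, f₁ s) + ∫ s in Ioo 0 t, f₂ s := integral_add hf₁i hf₂i
    _ ≤ (4 / β) * K₂ * A * r ^ β + (2 / (1 - β)) * K₃ * A * r ^ β := add_le_add hI₁ hI₂
    _ = ((4 / β) * K₂ + (2 / (1 - β)) * K₃) * A * r ^ β := by ring

/-! ## Derivatives fall on differentiable data -/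

omit [CompleteSpace F] in
/-- The derivative field of a strongly measurable family of differentiable slices is a strongly
measurable family. [folklore] -/
theorem stronglyMeasurable_fderiv_family (hgm : StronglyMeasurable (uncurry g))
    (hgd : ∀ s, Differentiable ℝ (g s)) :
    StronglyMeasurable (uncurry fun s y => fderiv ℝ (g s) y) := by
  classical
  have h := stronglyMeasurable_indicator_fderiv (S := (univ : Set ℝ)) MeasurableSet.univ hgm (fun s _ => hgd s)
  have hfun : (uncurry fun s y => fderiv ℝ (g s) y) =
      fun p : ℝ × E => if p.1 ∈ (univ : Set ℝ) then fderiv ℝ (g p.1) p.2 else 0 := by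
    funext p; simp [uncurry]
  rw [hfun]; exact h

omit [CompleteSpace F] in
/-- The iterated derivative fields of a strongly measurable family of `Cⁿ` slices are strongly
measurable families (`k ≤ n`). [folklore] -/
theorem stronglyMeasurable_iteratedFDeriv_family (hgm : StronglyMeasurable (uncurry g)) {n : ℕ}
    (hgn : ∀ s, ContDiff ℝ n (g s)) :
    ∀ k ≤ n, StronglyMeasurable (uncurry fun s y => iteratedFDeriv ℝ k (g s) y) := by
  intro k
  induction k with
  | zero =>
    intro _
    have hfun : (uncurry fun s y => iteratedFDeriv ℝ 0 (g s) y) =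
        fun p : ℝ × E => (continuousMultilinearCurryFin0 ℝ E F).symm (uncurry g p) := by
      funext p
      simp only [uncurry]
      ext m
      rw [iteratedFDeriv_zero_apply]
      rfl
    rw [hfun]
    exact (continuousMultilinearCurryFin0 ℝ E F).symm.continuous.comp_stronglyMeasurable hgm
  | succ k ih =>
    intro hk
    have hk' : k ≤ n := (Nat.le_succ k).trans hk
    have hG := ih hk'
    have hGd : ∀ s, Differentiable ℝ (fun y => iteratedFDeriv ℝ k (g s) y) := fun s =>
      (hgn s).differentiable_iteratedFDeriv (by exact_mod_cast hk)
    have hD := stronglyMeasurable_fderiv_family hG hGd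
    set L := (continuousMultilinearCurryLeftEquiv ℝ (fun _ : Fin (k + 1) => E) F).symm with hL
    have hfun : (uncurry fun s y => iteratedFDeriv ℝ (k + 1) (g s) y) =
        fun p : ℝ × E => L (uncurry (fun s y => fderiv ℝ (fun y => iteratedFDeriv ℝ k (g s) y) y) p) := by
      funext p
      simp only [uncurry]
      rw [iteratedFDeriv_succ_eq_comp_left]
      rfl
    rw [hfun]
    exact L.continuous.comp_stronglyMeasurable hD

/-- **Derivatives fall on `C¹` data**: if the slices are `C¹` with `g`, `Dg` uniformly bounded, then
`D(J[g])(t, x) = ∫₀ᵗ e^{(t-s)Δ}(Dg(s))(x) ds`. [folklore] -/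
theorem fderiv_duhamel_eq (hgm : StronglyMeasurable (uncurry g)) (hg1 : ∀ s, ContDiff ℝ 1 (g s))
    {C₀ C₁ : ℝ} (hC0 : ∀ s y, ‖g s y‖ ≤ C₀) (hC1 : ∀ s y, ‖fderiv ℝ (g s) y‖ ≤ C₁) (t : ℝ) (x : E) :
    fderiv ℝ (fun x => ∫ s in Ioo 0 t, heatExtension (g s) (t - s) x) x =
      ∫ s in Ioo 0 t, heatExtension (fderiv ℝ (g s)) (t - s) x := by
  rw [(hasFDerivAt_duhamel hgm (fun s => (hg1 s).continuous) hC0 t x).fderiv]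
  refine setIntegral_congr_fun measurableSet_Ioo fun s hs => ?_
  exact fderiv_heatExtension_of_bounded (hg1 s) (hC0 s) (hC1 s) (sub_pos.2 hs.2) x

/-- **Iterated derivatives fall on `Cⁿ` data**: if the slices are `Cⁿ` with `‖Dʲg(s)‖ ≤ C j` for
`j ≤ n`, then for `k ≤ n`, `Dᵏ(J[g])(t, ·) = J[Dᵏg](t, ·)` (the Duhamel integral of the
multilinear-map-valued family `Dᵏg`). Induction on `k` (`Dᵏ⁺¹ = curry⁻¹ ∘ D(Dᵏ)`), the previous lemma
for the bounded `C¹` family `Dᵏg`, and the commutation of `e^{σΔ}` and of the `s`-integral with the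
currying isometry. [folklore] -/
theorem iteratedFDeriv_duhamel_eq (hgm : StronglyMeasurable (uncurry g)) {n : ℕ}
    (hgn : ∀ s, ContDiff ℝ n (g s)) {Cj : ℕ → ℝ}
    (hCj : ∀ j ≤ n, ∀ s y, ‖iteratedFDeriv ℝ j (g s) y‖ ≤ Cj j) (t : ℝ) :
    ∀ k ≤ n, iteratedFDeriv ℝ k (fun x => ∫ s in Ioo 0 t, heatExtension (g s) (t - s) x) =
      fun x => ∫ s in Ioo 0 t, heatExtension (iteratedFDeriv ℝ k (g s)) (t - s) x := by
  intro k
  induction k with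
  | zero =>
    intro _
    funext x
    ext m
    rw [iteratedFDeriv_zero_apply]
    have h0 : ∀ s z, ‖g s z‖ ≤ Cj 0 := fun s z => by
      have := hCj 0 (Nat.zero_le _) s z
      rwa [norm_iteratedFDeriv_zero] at this
    set L : F →L[ℝ] E [×0]→L[ℝ] F :=
      ((continuousMultilinearCurryFin0 ℝ E F).symm : F →L[ℝ] E [×0]→L[ℝ] F) with hL
    have hint : IntegrableOn (fun s => heatExtension (g s) (t - s) x) (Ioo 0 t) volume :=
      integrableOn_lift_apply hgm h0 t x
    have e1 : (∫ s in Ioo 0 t, heatExtension (iteratedFDeriv ℝ 0 (g s)) (t - s) x) =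
        ∫ s in Ioo 0 t, L (heatExtension (g s) (t - s) x) := by
      refine setIntegral_congr_fun measurableSet_Ioo fun s hs => ?_
      have : iteratedFDeriv ℝ 0 (g s) = fun z => L (g s z) := by
        funext z; rw [iteratedFDeriv_zero_eq_comp]; rfl
      rw [this]
      exact heatExtension_clm_comp_of_bound L (hgn s).continuous (h0 s) (sub_pos.2 hs.2) x
    rw [e1, L.integral_comp_comm hint]
    simp [hL]
  | succ k ih =>
    intro hk
    have hk' : k ≤ n := (Nat.le_succ k).trans hk
    have hfun := ih hk'
    -- the family `G = Dᵏg`: `C¹`, bounded, with bounded derivative, measurable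
    set G : ℝ → E → E [×k]→L[ℝ] F := fun s => iteratedFDeriv ℝ k (g s) with hG
    have hG1 : ∀ s, ContDiff ℝ 1 (G s) := fun s => by
      have hk1 : 1 + k ≤ n := by omega
      exact (hgn s).iteratedFDeriv_right (i := k) (m := 1) (by exact_mod_cast hk1)
    have hG0 : ∀ s z, ‖G s z‖ ≤ Cj k := fun s => hCj k hk' s
    have hGd : ∀ s z, ‖fderiv ℝ (G s) z‖ ≤ Cj (k + 1) := fun s z => by
      rw [hG, norm_fderiv_iteratedFDeriv]
      exact hCj (k + 1) hk s z
    have hGm : StronglyMeasurable (uncurry G) := stronglyMeasurable_iteratedFDeriv_family hgm hgn k hk'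
    have hDGm : StronglyMeasurable (uncurry fun s y => fderiv ℝ (G s) y) :=
      stronglyMeasurable_fderiv_family hGm fun s => (hG1 s).differentiable one_ne_zero
    set L : (E →L[ℝ] E [×k]→L[ℝ] F) →L[ℝ] E [×(k + 1)]→L[ℝ] F :=
      ((continuousMultilinearCurryLeftEquiv ℝ (fun _ : Fin (k + 1) => E) F).symm.toContinuousLinearEquiv :
        (E →L[ℝ] E [×k]→L[ℝ] F) →L[ℝ] E [×(k + 1)]→L[ℝ] F) with hL
    funext x
    rw [iteratedFDeriv_succ_eq_comp_left, Function.comp_apply, hfun,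
      show (fun x => ∫ s in Ioo 0 t, heatExtension (iteratedFDeriv ℝ k (g s)) (t - s) x) =
        fun x => ∫ s in Ioo 0 t, heatExtension (G s) (t - s) x from rfl,
      fderiv_duhamel_eq hGm hG1 hG0 hGd t x]
    have hint : IntegrableOn (fun s => heatExtension (fderiv ℝ (G s)) (t - s) x) (Ioo 0 t) volume :=
      integrableOn_lift_apply (g := fun s y => fderiv ℝ (G s) y) hDGm hGd t x
    have e1 : (∫ s in Ioo 0 t, heatExtension (iteratedFDeriv ℝ (k + 1) (g s)) (t - s) x) =
        ∫ s in Ioo 0 t, L (heatExtension (fderiv ℝ (G s)) (t - s) x) := by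
      refine setIntegral_congr_fun measurableSet_Ioo fun s hs => ?_
      have : iteratedFDeriv ℝ (k + 1) (g s) = fun z => L (fderiv ℝ (G s) z) := by
        funext z; rw [iteratedFDeriv_succ_eq_comp_left]; rfl
      rw [this]
      exact heatExtension_clm_comp_of_bound L ((hG1 s).continuous_fderiv one_ne_zero) (hGd s)
        (sub_pos.2 hs.2) x
    rw [e1, L.integral_comp_comm hint]
    rfl

end Duhamel

/-! ## Time regularity -/

section Time

omit [MeasurableSpace E] [BorelSpace E] [CompleteSpace F] in
/-- `‖Δk(x)‖ ≤ d ‖D²k(x)‖`. [folklore] -/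
theorem norm_laplacian_le (k : E → F) (x : E) :
    ‖(Δ k) x‖ ≤ (Module.finrank ℝ E : ℝ) * ‖iteratedFDeriv ℝ 2 k x‖ := by
  set b := stdOrthonormalBasis ℝ E with hb
  rw [laplacian_eq_iteratedFDeriv_orthonormalBasis k b]
  dsimp only
  calc ‖∑ i, iteratedFDeriv ℝ 2 k x ![b i, b i]‖ ≤ ∑ i, ‖iteratedFDeriv ℝ 2 k x ![b i, b i]‖ := norm_sum_le _ _
    _ ≤ ∑ _i : Fin (Module.finrank ℝ E), ‖iteratedFDeriv ℝ 2 k x‖ := by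
        refine Finset.sum_le_sum fun i _ => ?_
        calc ‖iteratedFDeriv ℝ 2 k x ![b i, b i]‖ ≤ ‖iteratedFDeriv ℝ 2 k x‖ * ∏ j, ‖(![b i, b i]) j‖ :=
              ContinuousMultilinearMap.le_opNorm _ _
          _ = ‖iteratedFDeriv ℝ 2 k x‖ := by simp [Fin.prod_univ_two, b.orthonormal.1 i]
    _ = (Module.finrank ℝ E : ℝ) * ‖iteratedFDeriv ℝ 2 k x‖ := by
        rw [Finset.sum_const, Finset.card_univ, Fintype.card_fin, nsmul_eq_mul]

/-- **The heat flow moves bounded `C²` data at most linearly in time**: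
`‖e^{hΔ}k(x) - k(x)‖ ≤ d C₂ h` if `‖k‖ ≤ C₀`, `‖Dk‖ ≤ C₁`, `‖D²k‖ ≤ C₂` (`∂_τ e^{τΔ}k = e^{τΔ}Δk`,
`|Δk| ≤ d C₂`, and `e^{τΔ}k → k` as `τ → 0⁺`). [folklore] -/
theorem norm_heatExtension_sub_self_le_of_C2 {k : E → F} (hk : ContDiff ℝ 2 k) {C₀ C₁ C₂ : ℝ}
    (h0 : ∀ z, ‖k z‖ ≤ C₀) (h1 : ∀ z, ‖fderiv ℝ k z‖ ≤ C₁) (h2 : ∀ z, ‖iteratedFDeriv ℝ 2 k z‖ ≤ C₂)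
    {h : ℝ} (hh : 0 < h) (x : E) :
    ‖heatExtension k h x - k x‖ ≤ (Module.finrank ℝ E : ℝ) * C₂ * h := by
  set d : ℝ := (Module.finrank ℝ E : ℝ) with hd
  have hC₁ : 0 ≤ C₁ := (norm_nonneg _).trans (h1 x)
  have h2' : ∀ z, ‖fderiv ℝ (fderiv ℝ k) z‖ ≤ C₂ := fun z => by rw [norm_fderiv_fderiv_eq]; exact h2 z
  -- the Laplacian of `k` is bounded by `d C₂`, hence so is `e^{τΔ}Δk`
  have hΔ : ∀ z, ‖(Δ k) z‖ ≤ d * C₂ := fun z =>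
    (norm_laplacian_le k z).trans (mul_le_mul_of_nonneg_left (h2 z) (by positivity))
  set f : ℝ → F := fun τ => heatExtension k τ x with hf
  have hderiv : ∀ τ, 0 < τ → HasDerivAt f (heatExtension (Δ k) τ x) τ := fun τ hτ =>
    hasDerivAt_heatExtension_time_of_bounded hk h0 h1 h2' hτ x
  have hbound : ∀ τ, 0 < τ → ‖heatExtension (Δ k) τ x‖ ≤ d * C₂ := fun τ hτ =>
    norm_heatExtension_le_of_bound hΔ hτ x
  -- mean value on `[ε, h]`
  have hmv : ∀ ε, 0 < ε → ε ≤ h → ‖f h - f ε‖ ≤ d * C₂ * (h - ε) := by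
    intro ε hε hεh
    have key := norm_image_sub_le_of_norm_deriv_le_segment' (f := f) (f' := fun τ => heatExtension (Δ k) τ x)
      (fun τ hτ => (hderiv τ (hε.trans_le hτ.1)).hasDerivWithinAt)
      (fun τ hτ => hbound τ (hε.trans_le hτ.1)) h (right_mem_Icc.2 hεh)
    exact key
  -- `f ε → k x` as `ε → 0⁺` (Lipschitz data)
  have hlip : ∀ y z, ‖k y - k z‖ ≤ C₁ * ‖y - z‖ ^ (1 : ℝ) := fun y z => by
    rw [Real.rpow_one]
    exact Convex.norm_image_sub_le_of_norm_fderiv_le (fun w _ => (hk.differentiable (by norm_num)) w)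
      (fun w _ => h1 w) convex_univ (mem_univ z) (mem_univ y)
  set c : ℝ := (1 + 2 * (2 : ℝ) ^ ((Module.finrank ℝ E : ℝ) / 2)) with hc
  have hε : ∀ ε, 0 < ε → ‖f ε - k x‖ ≤ c * C₁ * ε ^ ((1 : ℝ) / 2) := fun ε hε =>
    norm_heatExtension_sub_self_le_of_holder hk.continuous h0 hC₁ zero_le_one le_rfl hlip hε x
  -- conclusion: let `ε → 0⁺`
  refine le_of_forall_pos_le_add fun δ hδ => ?_
  -- choose `ε ≤ h` with `c C₁ √ε ≤ δ`
  obtain ⟨ε, hε0, hεh, hεδ⟩ : ∃ ε, 0 < ε ∧ ε ≤ h ∧ c * C₁ * ε ^ ((1 : ℝ) / 2) ≤ δ := by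
    by_cases hcC : c * C₁ = 0
    · exact ⟨h, hh, le_rfl, by rw [hcC, zero_mul]; exact hδ.le⟩
    · have hcC0 : 0 < c * C₁ := lt_of_le_of_ne (by positivity) (Ne.symm hcC)
      refine ⟨min h ((δ / (c * C₁)) ^ (2 : ℝ)), lt_min hh (by positivity), min_le_left _ _, ?_⟩
      have hle : (min h ((δ / (c * C₁)) ^ (2 : ℝ))) ^ ((1 : ℝ) / 2) ≤ ((δ / (c * C₁)) ^ (2 : ℝ)) ^ ((1 : ℝ) / 2) :=
        Real.rpow_le_rpow (le_min hh.le (by positivity)) (min_le_right _ _) (by norm_num)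
      rw [← Real.rpow_mul (by positivity), show (2 : ℝ) * (1 / 2) = 1 by norm_num, Real.rpow_one] at hle
      calc c * C₁ * (min h ((δ / (c * C₁)) ^ (2 : ℝ))) ^ ((1 : ℝ) / 2) ≤ c * C₁ * (δ / (c * C₁)) :=
            mul_le_mul_of_nonneg_left hle hcC0.le
        _ = δ := mul_div_cancel₀ δ hcC
  calc ‖heatExtension k h x - k x‖ = ‖(f h - f ε) + (f ε - k x)‖ := by rw [hf]; congr 1; abel
    _ ≤ ‖f h - f ε‖ + ‖f ε - k x‖ := norm_add_le _ _
    _ ≤ d * C₂ * (h - ε) + c * C₁ * ε ^ ((1 : ℝ) / 2) := add_le_add (hmv ε hε0 hεh) (hε ε hε0)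
    _ ≤ d * C₂ * h + δ := by
        have hdC : 0 ≤ d * C₂ := by
          have : 0 ≤ C₂ := (norm_nonneg _).trans (h2 x)
          positivity
        nlinarith [hεδ, hdC, hε0]

omit [NormedSpace ℝ F] [CompleteSpace F] in
/-- **Lipschitz and bounded is Hölder**: `‖f x - f x'‖ ≤ max L (2B) ‖x - x'‖^β` for `0 < β ≤ 1` if
`f` is `L`-Lipschitz and bounded by `B`. [folklore] -/
theorem holder_of_lipschitz_of_bound {X : Type*} [NormedAddCommGroup X] {f : X → F} {L B β : ℝ}
    (hL : ∀ x x', ‖f x - f x'‖ ≤ L * ‖x - x'‖) (hB : ∀ x, ‖f x‖ ≤ B) (hβ0 : 0 < β) (hβ1 : β ≤ 1)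
    (x x' : X) : ‖f x - f x'‖ ≤ max L (2 * B) * ‖x - x'‖ ^ β := by
  have hB0 : 0 ≤ B := (norm_nonneg _).trans (hB x)
  set r : ℝ := ‖x - x'‖ with hr
  have hr0 : 0 ≤ r := norm_nonneg _
  by_cases hr1 : r ≤ 1
  · have hrr : r ≤ r ^ β := by
      rcases hr0.eq_or_lt with h | h
      · rw [← h, Real.zero_rpow hβ0.ne']
      · calc r = r ^ (1 : ℝ) := (Real.rpow_one r).symm
          _ ≤ r ^ β := Real.rpow_le_rpow_of_exponent_ge h hr1 hβ1
    calc ‖f x - f x'‖ ≤ L * r := hL x x'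
      _ ≤ max L (2 * B) * r ^ β := by
          rcases le_or_gt 0 L with hL0 | hL0
          · exact (mul_le_mul_of_nonneg_left hrr hL0).trans
              (mul_le_mul_of_nonneg_right (le_max_left _ _) (Real.rpow_nonneg hr0 _))
          · have : L * r ≤ 0 := mul_nonpos_of_nonpos_of_nonneg hL0.le hr0
            exact this.trans (mul_nonneg ((mul_nonneg zero_le_two hB0).trans (le_max_right _ _))
              (Real.rpow_nonneg hr0 _))
  · push Not at hr1
    have hrβ : 1 ≤ r ^ β := Real.one_le_rpow hr1.le hβ0.le
    calc ‖f x - f x'‖ ≤ ‖f x‖ + ‖f x'‖ := norm_sub_le _ _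
      _ ≤ 2 * B := by linarith [hB x, hB x']
      _ ≤ max L (2 * B) * r ^ β := by
          calc 2 * B = 2 * B * 1 := (mul_one _).symm
            _ ≤ max L (2 * B) * r ^ β :=
                mul_le_mul (le_max_right _ _) hrβ zero_le_one ((mul_nonneg zero_le_two hB0).trans (le_max_right _ _))

/-- **Lipschitz continuity in time of the Duhamel integral of Hölder data**: for `0 ≤ t' ≤ t`,
`‖J[g](t, x) - J[g](t', x)‖ ≤ (C + d K₂ A (2/β) t'^{β/2}) (t - t')`: the top layer
`∫_{t'}^{t} e^{(t-s)Δ}g(s) ds` is at most `C (t - t')`, and on the bottom layer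
`e^{(t-s)Δ}g(s) - e^{(t'-s)Δ}g(s) = (e^{(t-t')Δ} - 1) e^{(t'-s)Δ}g(s)` moves by at most
`(t - t') d ‖D² e^{(t'-s)Δ}g(s)‖ ≤ (t - t') d K₂ A (t'-s)^{(β-2)/2}`. [folklore] -/
theorem norm_duhamel_sub_duhamel_time_le {g : ℝ → E → F} {C : ℝ} (hgm : StronglyMeasurable (uncurry g))
    (hgc : ∀ s, Continuous (g s)) (hgC : ∀ s y, ‖g s y‖ ≤ C) {A β : ℝ} (hA : 0 ≤ A) (hβ0 : 0 < β)
    (hβ1 : β ≤ 1) (hgA : ∀ s y z, ‖g s y - g s z‖ ≤ A * ‖y - z‖ ^ β) {t t' : ℝ} (ht' : 0 ≤ t')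
    (htt : t' ≤ t) (x : E) :
    ‖(∫ s in Ioo 0 t, heatExtension (g s) (t - s) x) - ∫ s in Ioo 0 t', heatExtension (g s) (t' - s) x‖ ≤
      (C + (Module.finrank ℝ E : ℝ) * (4 * (2 : ℝ) ^ ((Module.finrank ℝ E : ℝ) / 2) *
        (2 * (2 : ℝ) ^ ((Module.finrank ℝ E : ℝ) / 2) * (1 + 2 * (2 : ℝ) ^ ((Module.finrank ℝ E : ℝ) / 2)))) *
        A * (2 / β) * t' ^ (β / 2)) * (t - t') := by
  set d : ℝ := (Module.finrank ℝ E : ℝ) with hd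
  set c : ℝ := (2 : ℝ) ^ ((Module.finrank ℝ E : ℝ) / 2) with hc
  set K₁ : ℝ := 2 * c * (1 + 2 * c) with hK₁
  set K₂ : ℝ := 4 * c * (2 * c * (1 + 2 * c)) with hK₂
  have hK₂0 : 0 ≤ K₂ := by positivity
  have hC0 : 0 ≤ C := (norm_nonneg _).trans (hgC 0 0)
  have hextra : 0 ≤ d * K₂ * A * (2 / β) * t' ^ (β / 2) := by positivity
  -- the case `t' = 0`
  rcases ht'.eq_or_lt with ht0 | ht0
  · subst ht0
    rw [Measure.restrict_eq_zero.2 (by simp : volume (Ioo (0 : ℝ) 0) = 0), integral_zero_measure, sub_zero]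
    rcases le_or_gt t 0 with ht | ht
    · have ht00 : t = 0 := le_antisymm ht htt
      subst ht00
      simp
    · calc ‖∫ s in Ioo 0 t, heatExtension (g s) (t - s) x‖ ≤ C * t := norm_duhamel_le hgC ht.le x
        _ ≤ _ := by
          rw [sub_zero]
          exact mul_le_mul_of_nonneg_right (le_add_of_nonneg_right hextra) ht.le
  -- the case `t' = t`
  rcases htt.eq_or_lt with htt' | htt'
  · subst htt'; simp
  -- `0 < t' < t`: split the time integral
  have hsplit : Ioo 0 t = Ioo 0 t' ∪ Ico t' t := (Ioo_union_Ico_eq_Ioo ht0 htt'.le).symm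
  have hdisj : Disjoint (Ioo 0 t') (Ico t' t) :=
    disjoint_left.2 fun s hs hs' => (lt_irrefl _) (hs.2.trans_le hs'.1)
  have hi1 : IntegrableOn (fun s => heatExtension (g s) (t - s) x) (Ioo 0 t') volume :=
    (integrableOn_lift_apply hgm hgC t x).mono_set (by rw [hsplit]; exact subset_union_left)
  have hi2 : IntegrableOn (fun s => heatExtension (g s) (t - s) x) (Ico t' t) volume :=
    (integrableOn_lift_apply hgm hgC t x).mono_set (by rw [hsplit]; exact subset_union_right)
  have hi3 : IntegrableOn (fun s => heatExtension (g s) (t' - s) x) (Ioo 0 t') volume :=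
    integrableOn_lift_apply hgm hgC t' x
  rw [hsplit, setIntegral_union hdisj measurableSet_Ico hi1 hi2, add_sub_right_comm,
    ← integral_sub hi1 hi3]
  -- the top layer
  have htop : ‖∫ s in Ico t' t, heatExtension (g s) (t - s) x‖ ≤ C * (t - t') := by
    have h := norm_setIntegral_le_of_norm_le_const (measure_Ico_lt_top (μ := (volume : Measure ℝ)) (a := t') (b := t))
      (fun s hs => norm_heatExtension_le_of_bound (hgC s) (sub_pos.2 hs.2) x)
      (f := fun s => heatExtension (g s) (t - s) x)
    rwa [measureReal_def, Real.volume_Ico, ENNReal.toReal_ofReal (by linarith)] at h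
  -- the bottom layer
  have hbot : ‖∫ s in Ioo 0 t', (heatExtension (g s) (t - s) x - heatExtension (g s) (t' - s) x)‖ ≤
      d * K₂ * A * (2 / β) * t' ^ (β / 2) * (t - t') := by
    have hint : IntegrableOn (fun s : ℝ => d * K₂ * A * (t - t') * (t' - s) ^ ((β - 2) / 2)) (Ioo 0 t') volume :=
      (integrableOn_rpow_sub (r := (β - 2) / 2) (by linarith) 0 t').const_mul _
    calc ‖∫ s in Ioo 0 t', (heatExtension (g s) (t - s) x - heatExtension (g s) (t' - s) x)‖
        ≤ ∫ s in Ioo 0 t', d * K₂ * A * (t - t') * (t' - s) ^ ((β - 2) / 2) := by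
          refine norm_integral_le_of_norm_le hint ?_
          filter_upwards [ae_restrict_mem measurableSet_Ioo] with s hs
          have hσ : 0 < t' - s := sub_pos.2 hs.2
          -- `e^{(t-s)Δ}g(s) = e^{(t-t')Δ}(e^{(t'-s)Δ}g(s))`
          set k : E → F := heatExtension (g s) (t' - s) with hk
          have hsemi : heatExtension (g s) (t - s) x = heatExtension k (t - t') x := by
            rw [hk, heatExtension_add_holds (memLp_top_of_continuous_of_bound (hgc s) (hgC s)) le_top hσ
              (sub_pos.2 htt'), show t' - s + (t - t') = t - s by ring]
          have hk2 : ContDiff ℝ 2 k := contDiff_heatExtension_of_bound (hgc s) (hgC s) hσ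
          have hk0 : ∀ z, ‖k z‖ ≤ C := fun z => norm_heatExtension_le_of_bound (hgC s) hσ z
          have hk1 : ∀ z, ‖fderiv ℝ k z‖ ≤ K₁ * A * (t' - s) ^ ((β - 1) / 2) := fun z =>
            norm_fderiv_heatExtension_le_holder (hgc s) (hgC s) hA hβ0.le hβ1 (hgA s) hσ z
          have hk2b : ∀ z, ‖iteratedFDeriv ℝ 2 k z‖ ≤ K₂ * A * (t' - s) ^ ((β - 2) / 2) := fun z =>
            norm_iteratedFDeriv_two_heatExtension_le_holder (hgc s) (hgC s) hA hβ0.le hβ1 (hgA s) hσ z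
          rw [hsemi]
          calc ‖heatExtension k (t - t') x - k x‖ ≤ d * (K₂ * A * (t' - s) ^ ((β - 2) / 2)) * (t - t') :=
                norm_heatExtension_sub_self_le_of_C2 hk2 hk0 hk1 hk2b (sub_pos.2 htt') x
            _ = d * K₂ * A * (t - t') * (t' - s) ^ ((β - 2) / 2) := by ring
      _ = d * K₂ * A * (t - t') * ∫ s in Ioo 0 t', (t' - s) ^ ((β - 2) / 2) := integral_const_mul _ _
      _ = d * K₂ * A * (2 / β) * t' ^ (β / 2) * (t - t') := by
          rw [setIntegral_rpow_sub (by linarith) ht0.le, sub_zero, show (β - 2) / 2 + 1 = β / 2 by ring]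
          field_simp
  calc ‖(∫ s in Ioo 0 t', (heatExtension (g s) (t - s) x - heatExtension (g s) (t' - s) x)) +
        ∫ s in Ico t' t, heatExtension (g s) (t - s) x‖
      ≤ ‖∫ s in Ioo 0 t', (heatExtension (g s) (t - s) x - heatExtension (g s) (t' - s) x)‖ +
        ‖∫ s in Ico t' t, heatExtension (g s) (t - s) x‖ := norm_add_le _ _
    _ ≤ d * K₂ * A * (2 / β) * t' ^ (β / 2) * (t - t') + C * (t - t') := add_le_add hbot htop
    _ = (C + d * K₂ * A * (2 / β) * t' ^ (β / 2)) * (t - t') := by ring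

end Time

end HeatHolder

end Literature.Analysis.UnboundedOperators
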